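import Literature.MathematicalPhysics.QuantumFieldTheory.Balaban1983to89.B9Eq386Neumann
import Literature.MathematicalPhysics.QuantumFieldTheory.Balaban1983to89.B6RandomWalkHom
import Literature.MathematicalPhysics.QuantumFieldTheory.Balaban1983to89.B9Eq352ScalarFluct
import Literature.MathematicalPhysics.QuantumFieldTheory.Balaban1983to89.B9Eq386NeumannAnalytic

/-!
# `Balaban1983to89.B9Eq360Vprime` — B9 (3.60)–(3.65) p. 402: the operator `V′(A)` DEFINED by (3.60), the bound (3.61)
# PROVED from (3.54) and (3.58), and the Neumann step (3.62)/(3.64)/(3.65) with the EXISTENCE of `G′(U′U)` on the finite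
# lattice (discharging the hypotheses `h361` of `B6RandomWalkHom.b9_363_of_361` and `h365`/`hS` of `B9Thm34Ext`)

statement-level skeleton of published theorems with citation tags; proofs where landed; nothing here is a claim about the Yang–Mills mass gap

DOCFIX (cell `lit-balaban`, seat r06 gen 15, 2026-08-22; p37 `CITELOC-SWEEP-B4B9.md` §2b page-numeral slips, text layer re-read): (3.57) is p. 401 [PDF 13] ((3.58)–(3.65) p. 402, (3.65)bis–(3.68) p. 403) — the locators of (3.57), (3.57)–(3.59), (3.57)–(3.60) in this file corrected accordingly (4 place(s)); declarations, statements and proofs byte-identical to the tree copy of record (p245592 + later appends).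

T. Bałaban, *Propagators for lattice gauge theories in a background field*, Commun. Math. Phys. **99** (1985) 389–434
[Balaban1985BackgroundPropagators] (cell paper B9; PDF held `paper:balaban1985-cmp99-background-propagators`, journal page =
PDF page + 388; the page quoted below, p. 402 = render `…-p014-x2.png`, was READ AS AN IMAGE by this seat, 2026-08-21).
Cell `lit-balaban` (HOME `run/shared/lean/pub/lit-balaban/`), SKELETON row **B9.Eq3.60** (= (3.60)–(3.61)) and the (3.62)–(3.65)
part of row **B9.Eq3.62**; reader/typer seat r06 (B9 block owner), gen 2.  Referee group ref-4.

CITATION HEADER / WHAT IS IN PRINT (p. 402 [PDF 14], verbatim).  *"We have a similar expansion for the adjoint operator. We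
denote operators in this expansion by adding a star as a superscript. Let us remark that F′₂*,ⱼ(A) is not an adjoint of
F′₂,ⱼ(A). Combining (3.53) and (3.59) we get
  Δ_{U′U} + Q′*(U′U)aQ′(U′U) = Δ_U + Q′*(U)aQ′(U) − V′₁(A) + F′₂*(A)aQ′(U) + Q′*(U)aF′₂(A) + F′₂*(A)aF′₂(A)
                             = Δ_U + Q′*(U)aQ′(U) − V′(A),                                                    (3.60)
where V′(A) is defined by the last equality. It satisfies the bound
  |(V′(A)λ)(x)| ≦ O(1)α₁((L^jη)^{−1}|∇_Uλ| + (L^jη)^{−2}|λ|)                                                    (3.61)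
for x ∈ B^j(Λ_j), the norms on the right-hand side restricted to the block B^j(y) containing the point x. It is an analytic
function of A on the domain (3.37), for α₁ sufficiently small.  We assume that Theorem 3.1 is valid for the operator G′(U).
The equality (3.60) can be written as
  Δ_{U′U} + Q′*(U′U)aQ′(U′U) = (I − V′(A)G′(U))(Δ_U + Q′*(U)aQ′(U)),                                             (3.62)
and the operator V′(A)G′(U) satisfies the bound |(V′(A)G′(U)λ)(x)| ≦ O(1)B₀α₁e^{−δ₀d(y,y′)} (3.63) for x ∈ Δ(y),
supp λ ⊂ Δ(y′), or the bound |V′(A)G′(U)λ|_{(γ)} ≦ O(1)B₀α₁|λ|_{(γ)}. Thus for α₁ sufficiently small the norm of this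
operator is small and I − V′(A)G′(U) is an invertible operator, the inverse is given by a convergent Neumann series. This
implies the existence of the operator G′(U′U) and the equality
  G′(U′U) = G′(U)(I − V′(A)G′(U))^{−1} = Σ_{n=0}^{∞} G′(U)(V′(A)G′(U))ⁿ.                                        (3.64)
Each term in the series is analytic in A on the domain (3.37), and the series is convergent uniformly, hence G′(U′U) is an
analytic function of A also. What is more important we have
  G′(U′U) = G′(U) + G′(U)V′(A)G′(U′U) = G′(U) + G′(U′U)V′(A)G′(U),                                               (3.65)"*.
The inputs quoted by these sentences: (3.53) p. 400 *"Δ_{U′U} = Δ_U − V′₁(A)"* and (3.54) p. 401 *"|(V′₁(A)λ)(x)| ≦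
4dα₁(L^jη)^{−1}|∇_Uλ| + 2dα₁(L^jη)^{−2}|λ| + 8dα₁²(L^jη)^{−2}|λ|, the norms on the right-hand side involve only nearest
neighbours of x because V′₁ is local"* (row B9.Eq3.50/B9.Eq3.54, this seat's `B9Eq352ScalarFluct`: `eq353`,
`norm_V1p_le_printed`); (3.57)–(3.59) pp. 401–402 *"(Q′ⱼ(U′U)λ)(y) = (Q′ⱼ(U)λ)(y) + (F′₂,ⱼ(A)λ)(y), (F′₂,ⱼ(A)λ)(y) =
Σ_{x∈B^j(y)} L^{−jd}F′₂,ⱼ(A; y, x)λ(x), … |F′₂,ⱼ(A; y, x)| ≦ O(1)α₁, (3.58) … |(F′₂,ⱼ(A)λ)(y)| ≦ O(1)α₁(Q′ⱼ|λ|)(y). (3.59)"*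
(row B9.Eq3.58, Phase-2 seat p06 `B9Eq358Decomposition`); the averaging operators (3.19) p. 393 *"(Q′ⱼ(U)λ)(y) =
Σ_{x∈B^j(y)} L^{−jd}R(U(Γ^{(j)}_{y,x}))λ(x)"* and the form (3.24) p. 394 *"⟨λ, Q′*aQ′λ⟩ = Σ_j a_j Σ_{y∈Λ_j}
(L^jη)^{d−2}|(Q′ⱼ(U)λ)(y)|²"* (so that, with the scalar products of p. 393, `(Q′*(U)ν)(x) = R(U(Γ^{(j)}_{y,x}))*ν(y)` for the
block `B^j(y) ∋ x` and `a` acts on `Λ_j` as the number `a_j(L^jη)^{−2}`).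

WHAT THIS FILE PROVES (0 sorry; no `def … : Prop` hypothesis is introduced — every declaration is a definition with a body or
a theorem).
* §1 (3.60)/(3.62) as ring algebra: `vPrime` := V′₁ − (F′₂*aQ′ + Q′*aF′₂ + F′₂*aF′₂) — THE DEFINITION (3.60) of V′(A) (it is
  `V′₁ + B9Eq386Neumann.pTwo`, the G-side letter of (3.82), `vPrime_eq`); `eq360_line1`/`eq360` = the two printed equalities
  of (3.60) from (3.53) and (3.57); `eq362` = (3.62) GIVEN the (silent) left-inverse property G′(U)Δ′_a(U) = 1 (it is
  `B9Eq386Neumann.eq384_factor`, reused, not restated).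
* §2 (3.61) PROVED in the block model of the cell's B9 files (`B6RandomWalk.HasMajorant` conventions: a fine lattice `X`
  with block map `blk : X → S` onto the averaging sites, values in a real normed space `E`): the block-average carriers are
  DEFINED with bodies — `kerOp` ((3.19)/(3.57): `ν(y) = Σ_{x∈B(y)} k(y,x)λ(x)`), `liftOp` (the starred operators `Q′*`, `F′₂*`:
  `λ(x) = s(x)ν(y_x)`), `diagOp` (`a` on `Λ_j`: `ν(y) ↦ a_j(L^jη)^{−2}ν(y)`), and `vPrimeOp` = (3.60) assembled from them and an
  arbitrary local operator `V′₁`; `norm_kerOp_le`/`norm_kerOp_le_avg` ((3.59)-shape: a kernel bound `|k(y,x)| ≦ CL^{−jd}α₁`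
  gives `|(F′₂λ)(y)| ≦ Cα₁(Q′|λ|)(y) ≦ Cα₁ sup_{B(y)}|λ|`); **`norm_vPrimeOp_le`** = (3.61) with the O(1) EXPLICIT: from the
  (3.54)-shape bound of `V′₁` with constants `c₁, c₂` and the (3.58)-shape kernel bounds with constant `C`,
  `|(V′(A)λ)(x)| ≦ c₁α₁(L^jη)^{−1}B₁ + (c₂ + a₀C(2 + Cα₁))α₁(L^jη)^{−2}B₂` whenever `|∇_Uλ| ≦ B₁`, `|λ| ≦ B₂` on the
  neighbourhoods the inputs use and on the block of `x`; `ineq361_blockForm` = the same in EXACTLY the binder shape `h361` of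
  `B6RandomWalkHom.b9_363_of_361` (scalar model), and **`b9_363_of_354_358`** = that theorem with `h361` DISCHARGED: (3.54)-shape
  + (3.58)-shape + (3.42)₁,₂ for G′(U) ⟹ (3.63).
* §3 (3.64)/(3.65) in a complete normed ring, REUSING `B9Eq386Neumann.gNew` (the (3.86) mechanism; nothing restated):
  `gPrimeExt` := G′(U)Σ(V′(A)G′(U))ⁿ; `eq364`; two-sided inverse of `Δ′_a(U) − V′(A)` (`deltaSub_mul_gPrimeExt`,
  `gPrimeExt_mul_deltaSub`); **both** printed forms of (3.65) (`eq365_left`, `eq365_right` — the second is new to the tree) and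
  the smallness of the two remainders (`norm_eq365_remainder_left/right_le`).
* §4 EXISTENCE ON THE FINITE LATTICE (*"Thus for α₁ sufficiently small the norm of this operator is small and I − V′(A)G′(U)
  is an invertible operator … This implies the existence of the operator G′(U′U)"*): for endomorphisms of `X → ℝ`, `X` finite,
  a block majorant of the (3.63) shape `θe^{−δ₀d(y,y′)}` plus Lemma 2.1 of [4] ((2.61), binder `Ineq261` of `B6RandomWalk`)
  bound the SUP-OPERATOR NORM by `θc₁(α)` (`abs_apply_le_rowSum_of_hasMajorant`, `opBound_of_363_261`, `opNorm_lt_one_of_363_261`); under `θc₁(α) < 1` the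
  operator `gPrimeExtEnd` (the series (3.64), summed in the Banach algebra of bounded operators and read back as a linear map)
  satisfies (3.65)₂ — **`eq365_end`** (and (3.65)₁ `eq365_end_left`, the two-sided inverse property
  `deltaSub_mul_gPrimeExtEnd`/`gPrimeExtEnd_mul_deltaSub`, bundled as `exists_gPrimeExt_of_363`) — which IS the binder
  `h365 : GpExt = GpU + GpExt * V` of
  `B9Thm34Ext.gpExt_entry1_of_365` / `B6RandomWalkHom.b9_leftEntry_of_361_365`; **`gpExt_entry1_of_363`** = Theorem 3.1's
  first inequality for THIS `G′(U′U)` with `h365` discharged (the remaining binders are the printed-shape inputs (3.42)₁,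
  (3.63), Lemma 2.1, exactly as in `B9Thm34Ext`).
* §6 (v1.1) the p. 403 expansion printed under the label (3.65) a second time (SKELETON row B9.Eq3.66): `cPrime` = `C′(A)`
  DEFINED as the printed six-operator sum; `sq_ext_expand` (`G′²(U′U)` by the two resolvent identities); **`eq365b`** = the
  seven-term expansion `Q′(U′U)G′²(U′U)Q′*(U′U) = Q′G′²Q′* + C′(A)` PROVED from (3.57) and (3.65) (ring algebra);
  `eq367_factor` = the first line of (3.67) with `C′(A)` the printed sum (the binder `h365 : L′ = L + Cp` of
  `B9Thm34Inv.factor_367` discharged); `eq365b_gPrimeExt` = the expansion for THE Neumann-series `G′(U′U)` of §3.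
* §7 (v1.1) `vPrimeFun`/`norm_vPrimeFun_le` = (3.61) pointwise for `V′₁` and `∇_U` given as plain maps, and the CONCRETE
  instance: `h354_V1p` = the (3.54)-shape input DERIVED for `V′₁(A) = B9Eq352ScalarFluct.V1p` (this seat's gen-1 file: (3.50)–(3.53)
  on the lattice `(T, U)` of `B9Eq39Adjoint`, unit-bounded background, `A` in the regime (3.37)) from `norm_V1p_le_printed`, and
  **`norm_vPrimeFun_V1p_le`** = (3.61) for that concrete `V′₁(A)` — the chain (3.50)–(3.54) ⟹ (3.61) kernel-connected.
* §8 (v1.2) (3.68) p.403 (SKELETON row B9.Eq3.68): `pOp` = `P(U) = G′Q′*(Q′G′²Q′*)^{−1}Q′G′`, `pPrime` = `P′(A) := P(U′U) − P(U)` DEFINED,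
  `eq368`; *"The remainder can be written explicitly … by writing the expansions of the operators determining P(U′U)"* carried out:
  `pPrime_telescope` (five one-difference words), `inv_sub_inv_of_367` (second resolvent identity for the inverses of (3.67)) and
  `pPrime_explicit` (every term of `P′(A)` carries one of `V′`, `F′₂`, `F′₂*`, `C′`).
* §9 (v1.3) analyticity in `A` of `G′(U′U)` (p. 402 after (3.64)): `analyticAt_gPrimeExt_comp`, `analyticOnNhd_gPrimeExt_comp` —
  `B9Eq386NeumannAnalytic.analyticAt_gNew_comp` (pub-balaban NE9 seat) read for `gPrimeExt`.
NOT REPRODUCED (binders or untouched, said once): the kernel bounds (3.63), (3.66)–(3.67) line 2, (3.68) line 2 (they are the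
`B9Thm34Ext`/`B9Thm34Inv` binders); (3.54) and (3.58) themselves at a general background (rows B9.Eq3.54 /
B9.Eq3.58: concrete files `B9Eq352ScalarFluct`, `B9Eq358Decomposition`); analyticity in `A` of `V′(A)` itself (§9 takes it as
the hypothesis `hV`); the Hölder / L² / weighted
entries; Theorem 3.1 for G′(U).  READING NOTE T9 (this seat): (3.54) bounds `V′₁λ(x)` by norms over the NEAREST NEIGHBOURS of
`x`, which for `x` on the boundary of its block `B^j(y)` lie in adjacent blocks, while (3.61) says *"restricted to the block
B^j(y) containing the point x"*; `norm_vPrimeOp_le` keeps both neighbourhood systems explicit (no claim either way), and the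
block form `ineq361_blockForm` records the print's reading as the hypothesis that `V′₁`'s input norms are block-restricted.
Value = kernel-checked bookkeeping of a printed definition, a printed "it satisfies the bound" and a printed "this implies
the existence"; NOT summit progress.
-/

namespace Literature.MathematicalPhysics.QuantumFieldTheory.Balaban1983to89.B9Eq360Vprime

open Literature.MathematicalPhysics.QuantumFieldTheory.Balaban1983to89

/-! ## §1 (3.60) and (3.62) as ring algebra -/

section Ring

variable {R : Type*} [Ring R]

/-- **`V′(A)`, DEFINED by (3.60)** (*"where V′(A) is defined by the last equality"*):
`V′(A) := V′₁(A) − (F′₂*(A)aQ′(U) + Q′*(U)aF′₂(A) + F′₂*(A)aF′₂(A))` — letters: `V₁ = V′₁(A)` of (3.53), `Qs = Q′*(U)`,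
`Q = Q′(U)`, `F₂ = F′₂(A)`, `F₂s = F′₂*(A)` of (3.57) and its starred twin, `a` = the operator of (3.24).
[cite: Balaban1985BackgroundPropagators, (3.60) p.402] -/
def vPrime (V₁ Qs Q F₂ F₂s a : R) : R := V₁ - (F₂s * a * Q + Qs * a * F₂ + F₂s * a * F₂)

/-- `V′(A) = V′₁(A) + P₂`-letter of the G-side expansion (3.82) (`B9Eq386Neumann.pTwo Qs Q F₂ F₂s a = −(F₂*aQ + Q*aF₂ +
F₂*aF₂)`): the Sect. B step uses the same three averaging terms for G′ and for G. [cite: Balaban1985BackgroundPropagators,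
(3.60) p.402, (3.82) p.407] -/
theorem vPrime_eq (V₁ Qs Q F₂ F₂s a : R) :
    vPrime V₁ Qs Q F₂ F₂s a = V₁ + B9Eq386Neumann.pTwo Qs Q F₂ F₂s a := by
  rw [vPrime, B9Eq386Neumann.pTwo, sub_eq_add_neg]

/-- **(3.60), first printed equality**: with (3.53) `Δ_{U′U} = Δ_U − V′₁(A)` and (3.57) `Q′(U′U) = Q′(U) + F′₂(A)`,
`Q′*(U′U) = Q′*(U) + F′₂*(A)`:
`Δ_{U′U} + Q′*(U′U)aQ′(U′U) = Δ_U + Q′*(U)aQ′(U) − V′₁(A) + F′₂*(A)aQ′(U) + Q′*(U)aF′₂(A) + F′₂*(A)aF′₂(A)`.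
[cite: Balaban1985BackgroundPropagators, (3.60) p.402, (3.53) p.400, (3.57) p.401] -/
theorem eq360_line1 (ΔU ΔU' Q Q' Qs Qs' a V₁ F₂ F₂s : R) (h353 : ΔU' = ΔU - V₁) (h357 : Q' = Q + F₂)
    (h357s : Qs' = Qs + F₂s) :
    ΔU' + Qs' * a * Q' = ΔU + Qs * a * Q - V₁ + F₂s * a * Q + Qs * a * F₂ + F₂s * a * F₂ := by
  rw [h353, B9Eq386Neumann.qStar_a_q_expand Qs Q F₂ F₂s a Q' Qs' h357 h357s]
  abel

/-- **(3.60), second printed equality**: `Δ_{U′U} + Q′*(U′U)aQ′(U′U) = Δ_U + Q′*(U)aQ′(U) − V′(A)`.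
[cite: Balaban1985BackgroundPropagators, (3.60) p.402] -/
theorem eq360 (ΔU ΔU' Q Q' Qs Qs' a V₁ F₂ F₂s : R) (h353 : ΔU' = ΔU - V₁) (h357 : Q' = Q + F₂)
    (h357s : Qs' = Qs + F₂s) :
    ΔU' + Qs' * a * Q' = ΔU + Qs * a * Q - vPrime V₁ Qs Q F₂ F₂s a := by
  rw [eq360_line1 ΔU ΔU' Q Q' Qs Qs' a V₁ F₂ F₂s h353 h357 h357s, vPrime]
  abel

/-- **(3.62)**: `Δ_{U′U} + Q′*(U′U)aQ′(U′U) = (I − V′(A)G′(U))(Δ_U + Q′*(U)aQ′(U))` — by (3.60) the left side is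
`Δ′ − V′(A)` with `Δ′ := Δ_U + Q′*(U)aQ′(U)` (= `Δ′_a(U)` of (3.24), Dirichlet-restricted), and the factorisation uses the
LEFT-inverse property `G′(U)Δ′ = 1` of `G′(U) = (Δ′_a)^{−1}` silently (it is `B9Eq386Neumann.eq384_factor`; that the inverse
property is load-bearing is `B9Eq386Neumann.eq384_factor_needs_inverse`). [cite: Balaban1985BackgroundPropagators, (3.62) p.402] -/
theorem eq362 (ΔU ΔU' Q Q' Qs Qs' a V₁ F₂ F₂s Gp : R) (h353 : ΔU' = ΔU - V₁) (h357 : Q' = Q + F₂)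
    (h357s : Qs' = Qs + F₂s) (hG : Gp * (ΔU + Qs * a * Q) = 1) :
    ΔU' + Qs' * a * Q' = (1 - vPrime V₁ Qs Q F₂ F₂s a * Gp) * (ΔU + Qs * a * Q) := by
  rw [eq360 ΔU ΔU' Q Q' Qs Qs' a V₁ F₂ F₂s h353 h357 h357s]
  exact B9Eq386Neumann.eq384_factor _ _ _ hG

end Ring

/-! ## §3 (3.64)/(3.65): the Neumann series in a complete normed ring (mechanism = `B9Eq386Neumann.gNew`) -/

section Neumann

variable {R : Type*} [NormedRing R] [CompleteSpace R]

/-- **`G′(U′U)` of (3.64)**: `G′(U′U) := G′(U)Σ_{n≥0}(V′(A)G′(U))ⁿ` — THE SAME series mechanism as (3.86) for `G`, so this is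
`B9Eq386Neumann.gNew` by definition (letters `Gp = G′(U)`, `Vp = V′(A)`). [cite: Balaban1985BackgroundPropagators, (3.64) p.402] -/
noncomputable def gPrimeExt (Gp Vp : R) : R := B9Eq386Neumann.gNew Gp Vp

omit [CompleteSpace R] in
/-- **(3.64), second equality**: `G′(U′U) = Σ_{n=0}^∞ G′(U)(V′(A)G′(U))ⁿ` (as `G′(U)·Σ(V′G′)ⁿ`, by definition).
[cite: Balaban1985BackgroundPropagators, (3.64) p.402] -/
theorem eq364 (Gp Vp : R) : gPrimeExt Gp Vp = Gp * ∑' n : ℕ, (Vp * Gp) ^ n := rfl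

/-- (3.64) term by term: `G′(U′U) = Σ_n G′(U)(V′(A)G′(U))ⁿ`, convergent for `‖V′(A)G′(U)‖ < 1`.
[cite: Balaban1985BackgroundPropagators, (3.64) p.402] -/
theorem eq364_tsum (Gp Vp : R) (h : ‖Vp * Gp‖ < 1) :
    gPrimeExt Gp Vp = ∑' n : ℕ, Gp * (Vp * Gp) ^ n :=
  B9Eq386Neumann.gNew_eq_tsum Gp Vp h

/-- **(3.64), first equality**: `G′(U′U) = G′(U)(I − V′(A)G′(U))^{−1}` (*"the inverse is given by a convergent Neumann
series"*), for `‖V′(A)G′(U)‖ < 1`. [cite: Balaban1985BackgroundPropagators, (3.64) p.402] -/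
theorem eq364_inverse_form (Gp Vp : R) (h : ‖Vp * Gp‖ < 1) :
    gPrimeExt Gp Vp = Gp * Ring.inverse (1 - Vp * Gp) :=
  B9Eq386Neumann.gNew_eq_mul_inverse Gp Vp h

/-- *"I − V′(A)G′(U) is an invertible operator"* for `‖V′(A)G′(U)‖ < 1`. [cite: Balaban1985BackgroundPropagators, (3.64) p.402] -/
theorem isUnit_one_sub (Gp Vp : R) (h : ‖Vp * Gp‖ < 1) : IsUnit (1 - Vp * Gp) :=
  ⟨Units.oneSub (Vp * Gp) h, rfl⟩

/-- *"This implies the existence of the operator G′(U′U)"*, right-inverse half: with `Δ′ := Δ_U + Q′*(U)aQ′(U)` and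
`Δ′G′(U) = 1`, the operator (3.62) `Δ′ − V′(A)` times `G′(U′U)` is `1`. [cite: Balaban1985BackgroundPropagators, (3.62)–(3.64) p.402] -/
theorem deltaSub_mul_gPrimeExt (Δp Vp Gp : R) (hΔG : Δp * Gp = 1) (h : ‖Vp * Gp‖ < 1) :
    (Δp - Vp) * gPrimeExt Gp Vp = 1 :=
  B9Eq386Neumann.sub_mul_gNew Δp Vp Gp hΔG h

/-- … left-inverse half: with `G′(U)Δ′ = 1`, `G′(U′U)(Δ′ − V′(A)) = 1`. [cite: Balaban1985BackgroundPropagators, (3.62)–(3.64) p.402] -/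
theorem gPrimeExt_mul_deltaSub (Δp Vp Gp : R) (hGΔ : Gp * Δp = 1) (h : ‖Vp * Gp‖ < 1) :
    gPrimeExt Gp Vp * (Δp - Vp) = 1 :=
  B9Eq386Neumann.gNew_mul_sub Δp Vp Gp hGΔ h

/-- Uniqueness: `G′(U′U)` IS the inverse of `Δ_{U′U} + Q′*(U′U)aQ′(U′U) = Δ′ − V′(A)` (any left inverse equals the series).
[cite: Balaban1985BackgroundPropagators, (3.64) p.402] -/
theorem leftInverse_eq_gPrimeExt (Δp Vp Gp G' : R) (hΔG : Δp * Gp = 1) (h : ‖Vp * Gp‖ < 1)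
    (h' : G' * (Δp - Vp) = 1) : G' = gPrimeExt Gp Vp :=
  B9Eq386Neumann.leftInverse_eq_gNew Δp Vp Gp G' hΔG h h'

/-- **(3.65), first form**: `G′(U′U) = G′(U) + G′(U)V′(A)G′(U′U)`. [cite: Balaban1985BackgroundPropagators, (3.65) p.402] -/
theorem eq365_left (Gp Vp : R) (h : ‖Vp * Gp‖ < 1) :
    gPrimeExt Gp Vp = Gp + Gp * Vp * gPrimeExt Gp Vp := by
  have e := B9Eq386Neumann.gNew_sub_G Gp Vp h
  rw [gPrimeExt]
  rw [sub_eq_iff_eq_add'] at e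
  exact e

/-- **(3.65), second form**: `G′(U′U) = G′(U) + G′(U′U)V′(A)G′(U)` (from `Σ(V′G′)ⁿ = 1 + (Σ(V′G′)ⁿ)V′G′`).
[cite: Balaban1985BackgroundPropagators, (3.65) p.402] -/
theorem eq365_right (Gp Vp : R) (h : ‖Vp * Gp‖ < 1) :
    gPrimeExt Gp Vp = Gp + gPrimeExt Gp Vp * Vp * Gp := by
  have e := geom_series_mul_neg (Vp * Gp) h
  -- e : (∑' i, (Vp*Gp)^i) * (1 - Vp*Gp) = 1
  have e' : ∑' i : ℕ, (Vp * Gp) ^ i = 1 + (∑' i : ℕ, (Vp * Gp) ^ i) * (Vp * Gp) := by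
    have := e
    rw [mul_sub, mul_one, sub_eq_iff_eq_add] at this
    exact this
  rw [gPrimeExt, B9Eq386Neumann.gNew]
  calc Gp * ∑' n : ℕ, (Vp * Gp) ^ n
      = Gp * (1 + (∑' i : ℕ, (Vp * Gp) ^ i) * (Vp * Gp)) := by rw [← e']
    _ = Gp + Gp * (∑' n : ℕ, (Vp * Gp) ^ n) * Vp * Gp := by noncomm_ring

/-- *"and norms of the second operators on the right-hand sides are small"* (p. 403 l. 1), first form:
`‖G′(U)V′(A)G′(U′U)‖ ≦ ‖G′(U)‖·‖V′(A)G′(U)‖·(‖1‖ − 1 + (1 − ‖V′(A)G′(U)‖)^{−1})` — small with `‖V′G′‖ = O(α₁)`.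
[cite: Balaban1985BackgroundPropagators, (3.65) p.402–403] -/
theorem norm_eq365_remainder_left_le (Gp Vp : R) (h : ‖Vp * Gp‖ < 1) :
    ‖Gp * Vp * gPrimeExt Gp Vp‖ ≤ ‖Gp‖ * ‖Vp * Gp‖ * (‖(1 : R)‖ - 1 + (1 - ‖Vp * Gp‖)⁻¹) := by
  have e : Gp * Vp * gPrimeExt Gp Vp = gPrimeExt Gp Vp - Gp := by
    have h1 := eq365_left Gp Vp h
    calc Gp * Vp * gPrimeExt Gp Vp = (Gp + Gp * Vp * gPrimeExt Gp Vp) - Gp := by abel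
      _ = gPrimeExt Gp Vp - Gp := by rw [← h1]
  have e2 : gPrimeExt Gp Vp - Gp = B9Eq386Neumann.gNew Gp Vp - Gp := rfl
  rw [e, e2]
  exact B9Eq386Neumann.norm_gNew_sub_G_le Gp Vp h

/-- … second form: `‖G′(U′U)V′(A)G′(U)‖` has the same bound (it is the same element `G′(U′U) − G′(U)`).
[cite: Balaban1985BackgroundPropagators, (3.65) p.402–403] -/
theorem norm_eq365_remainder_right_le (Gp Vp : R) (h : ‖Vp * Gp‖ < 1) :
    ‖gPrimeExt Gp Vp * Vp * Gp‖ ≤ ‖Gp‖ * ‖Vp * Gp‖ * (‖(1 : R)‖ - 1 + (1 - ‖Vp * Gp‖)⁻¹) := by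
  have e : gPrimeExt Gp Vp * Vp * Gp = gPrimeExt Gp Vp - Gp := by
    have h1 := eq365_right Gp Vp h
    calc gPrimeExt Gp Vp * Vp * Gp = (Gp + gPrimeExt Gp Vp * Vp * Gp) - Gp := by abel
      _ = gPrimeExt Gp Vp - Gp := by rw [← h1]
  have e2 : gPrimeExt Gp Vp - Gp = B9Eq386Neumann.gNew Gp Vp - Gp := rfl
  rw [e, e2]
  exact B9Eq386Neumann.norm_gNew_sub_G_le Gp Vp h

omit [CompleteSpace R] in
/-- *"for α₁ sufficiently small the norm of this operator is small"*, as a NUMBER: if `‖V′(A)G′(U)‖ ≦ κ₀B₀α₁` (the second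
form of (3.63)) and `α₁ < (κ₀B₀)^{−1}` then `‖V′(A)G′(U)‖ < 1`. [cite: Balaban1985BackgroundPropagators, (3.63)–(3.64) p.402] -/
theorem norm_lt_one_of_363 (W : R) (κ₀B₀ α₁ : ℝ) (hκ : 0 < κ₀B₀) (hW : ‖W‖ ≤ κ₀B₀ * α₁) (hα : α₁ < κ₀B₀⁻¹) :
    ‖W‖ < 1 :=
  B9Eq386Neumann.norm_lt_one_of_le_mul W κ₀B₀ α₁ hW (B9Eq386Neumann.mul_lt_one_of_lt_inv κ₀B₀ α₁ hκ hα)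

end Neumann

/-! ## §2 (3.61) in the block model: the averaging carriers WITH BODIES and the estimate -/

section BlockModel

variable {X S : Type*} [Fintype X] [DecidableEq S]
variable {E : Type*} [NormedAddCommGroup E] [NormedSpace ℝ E]

/-- The block `B(y) = {x : blk x = y}` of an averaging site `y` (p. 393: *"Λ_j = Ω_j^{(j)} ∖ Ω_{j+1}^{(j)} … Ω_j ∖ Ω_{j+1} =
B^j(Λ_j)"*; `blk` = the block map `x ↦ y` with `x ∈ B^j(y)`), as a `Finset`. [cite: Balaban1985BackgroundPropagators, (3.19) p.393] -/
def block (blk : X → S) (y : S) : Finset X := Finset.univ.filter fun x => blk x = y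

omit [DecidableEq S] in
/-- Membership in `block`. [cite: Balaban1985BackgroundPropagators, (3.19) p.393] -/
theorem mem_block [DecidableEq S] (blk : X → S) (y : S) (x : X) : x ∈ block blk y ↔ blk x = y := by
  simp [block]

/-- **Block-local kernel operators** `(X → E) → (S → E)`: `(Kλ)(y) = Σ_{x∈B(y)} k(y, x)λ(x)` — the SHAPE of the averaging
operator (3.19) `(Q′ⱼ(U)λ)(y) = Σ_{x∈B^j(y)} L^{−jd}R(U(Γ^{(j)}_{y,x}))λ(x)` (`k(y,x) = L^{−jd}R(U(Γ^{(j)}_{y,x}))`) and of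
`F′₂,ⱼ(A)` in (3.57) (`k(y,x) = L^{−jd}F′₂,ⱼ(A; y, x)`); `k(y, x)` is a bounded linear map of the value space (for 𝔤-valued `λ`:
the adjoint action `R(·)`, an isometry). [cite: Balaban1985BackgroundPropagators, (3.19) p.393, (3.57) p.401] -/
noncomputable def kerOp (blk : X → S) (k : S → X → E →L[ℝ] E) : (X → E) →ₗ[ℝ] (S → E) where
  toFun μ y := ∑ x ∈ block blk y, k y x (μ x)
  map_add' μ ν := by
    funext y
    simp only [Pi.add_apply, map_add, Finset.sum_add_distrib]
  map_smul' r μ := by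
    funext y
    simp only [Pi.smul_apply, map_smul, RingHom.id_apply, Finset.smul_sum]

omit [DecidableEq S] in
/-- `(Kλ)(y) = Σ_{x∈B(y)} k(y, x)λ(x)`. [cite: Balaban1985BackgroundPropagators, (3.19) p.393] -/
theorem kerOp_apply [DecidableEq S] (blk : X → S) (k : S → X → E →L[ℝ] E) (μ : X → E) (y : S) :
    kerOp blk k μ y = ∑ x ∈ block blk y, k y x (μ x) := rfl

/-- **The starred (transposed-shape) operators** `(S → E) → (X → E)`: `(K*ν)(x) = s(x)ν(y_x)`, `y_x` = the averaging site of
the block containing `x` — the SHAPE of `Q′*(U)` (from the form (3.24) and the scalar products of p. 393: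
`(Q′ⱼ*(U)ν)(x) = R(U(Γ^{(j)}_{y,x}))*ν(y)` for `x ∈ B^j(y)`, the weights `(L^jη)^d·L^{−jd}·η^{−d} = 1` cancelling) and of
`F′₂*,ⱼ(A)` (*"We denote operators in this expansion by adding a star as a superscript"*).
[cite: Balaban1985BackgroundPropagators, (3.24) p.394, (3.57)–(3.60) pp.401–402] -/
def liftOp (blk : X → S) (s : X → E →L[ℝ] E) : (S → E) →ₗ[ℝ] (X → E) where
  toFun ν x := s x (ν (blk x))
  map_add' μ ν := by
    funext x
    simp only [Pi.add_apply, map_add]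
  map_smul' r μ := by
    funext x
    simp only [Pi.smul_apply, map_smul, RingHom.id_apply]

omit [Fintype X] [DecidableEq S] in
/-- `(K*ν)(x) = s(x)ν(y_x)`. [cite: Balaban1985BackgroundPropagators, (3.24) p.394] -/
theorem liftOp_apply (blk : X → S) (s : X → E →L[ℝ] E) (ν : S → E) (x : X) :
    liftOp blk s ν x = s x (ν (blk x)) := rfl

/-- **The operator `a` of (3.24)** on functions of the averaging sites: `(aν)(y) = c(y)ν(y)` with `c(y) = a_j(L^jη)^{−2}` for
`y ∈ Λ_j` (read off the quadratic form (3.24): `⟨λ, Q′*aQ′λ⟩ = Σ_j a_j Σ_{y∈Λ_j} (L^jη)^{d−2}|(Q′ⱼλ)(y)|²` with the weight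
`(L^jη)^d` of the scalar product on `Λ_j`). [cite: Balaban1985BackgroundPropagators, (3.24) p.394] -/
def diagOp (c : S → ℝ) : (S → E) →ₗ[ℝ] (S → E) where
  toFun ν y := c y • ν y
  map_add' μ ν := by
    funext y
    simp only [Pi.add_apply, smul_add]
  map_smul' r μ := by
    funext y
    simp only [Pi.smul_apply, RingHom.id_apply, smul_comm (c y) r]

omit [Fintype X] [DecidableEq S] in
/-- `(aν)(y) = c(y)ν(y)`. [cite: Balaban1985BackgroundPropagators, (3.24) p.394] -/
theorem diagOp_apply (c : S → ℝ) (ν : S → E) (y : S) : diagOp c ν y = c y • ν y := rfl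

/-- **`V′(A)` of (3.60) as an operator on the fine-lattice functions**: `V′(A) = V′₁(A) − (F′₂*(A)aQ′(U) + Q′*(U)aF′₂(A) +
F′₂*(A)aF′₂(A))`, with `Q′(U) = kerOp kQ`, `F′₂(A) = kerOp kF`, `Q′*(U) = liftOp sQ`, `F′₂*(A) = liftOp sF`, `a = diagOp c` and
`V′₁(A)` an arbitrary (local) operator `V₁`. [cite: Balaban1985BackgroundPropagators, (3.60) p.402] -/
noncomputable def vPrimeOp (V₁ : Module.End ℝ (X → E)) (blk : X → S) (kQ kF : S → X → E →L[ℝ] E)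
    (sQ sF : X → E →L[ℝ] E) (c : S → ℝ) : Module.End ℝ (X → E) :=
  V₁ - (liftOp blk sF ∘ₗ diagOp c ∘ₗ kerOp blk kQ + liftOp blk sQ ∘ₗ diagOp c ∘ₗ kerOp blk kF
    + liftOp blk sF ∘ₗ diagOp c ∘ₗ kerOp blk kF)

/-- **(3.60) at the operator level** (two function spaces): with `Δ_{U′U} = Δ_U − V′₁(A)` (3.53),
`Q′(U′U) = Q′(U) + F′₂(A)` and `Q′*(U′U) = Q′*(U) + F′₂*(A)` (3.57),
`Δ_{U′U} + Q′*(U′U)aQ′(U′U) = Δ_U + Q′*(U)aQ′(U) − V′(A)`. [cite: Balaban1985BackgroundPropagators, (3.60) p.402] -/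
theorem eq360_op (ΔU ΔU' V₁ : Module.End ℝ (X → E)) (blk : X → S) (kQ kF kQ' : S → X → E →L[ℝ] E)
    (sQ sF sQ' : X → E →L[ℝ] E) (c : S → ℝ) (h353 : ΔU' = ΔU - V₁)
    (h357 : kerOp blk kQ' = kerOp blk kQ + kerOp blk kF) (h357s : liftOp blk sQ' = liftOp blk sQ + liftOp blk sF) :
    ΔU' + liftOp blk sQ' ∘ₗ diagOp c ∘ₗ kerOp blk kQ'
      = ΔU + liftOp blk sQ ∘ₗ diagOp c ∘ₗ kerOp blk kQ - vPrimeOp V₁ blk kQ kF sQ sF c := by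
  rw [h353, h357, h357s, vPrimeOp]
  simp only [LinearMap.comp_add, LinearMap.add_comp]
  abel

omit [DecidableEq S] in
/-- `V′(A)λ` evaluated at a point: the four terms of (3.60). [cite: Balaban1985BackgroundPropagators, (3.60) p.402] -/
theorem vPrimeOp_apply [DecidableEq S] (V₁ : Module.End ℝ (X → E)) (blk : X → S) (kQ kF : S → X → E →L[ℝ] E)
    (sQ sF : X → E →L[ℝ] E) (c : S → ℝ) (μ : X → E) (x : X) :
    vPrimeOp V₁ blk kQ kF sQ sF c μ x
      = V₁ μ x - (sF x (c (blk x) • kerOp blk kQ μ (blk x)) + sQ x (c (blk x) • kerOp blk kF μ (blk x))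
          + sF x (c (blk x) • kerOp blk kF μ (blk x))) := by
  simp only [vPrimeOp, LinearMap.sub_apply, LinearMap.add_apply, LinearMap.comp_apply, Pi.sub_apply, Pi.add_apply,
    liftOp_apply, diagOp_apply]

/-- **Norm of a block sum.**  If `|k(y, x)| ≦ κ` and `|λ(x)| ≦ B` for `x ∈ B(y)` then `|(Kλ)(y)| ≦ |B(y)|·κ·B`.
[cite: Balaban1985BackgroundPropagators, (3.58)–(3.59) p.402] -/
theorem norm_kerOp_le (blk : X → S) (k : S → X → E →L[ℝ] E) (μ : X → E) (y : S) {κ B : ℝ} (hκ : 0 ≤ κ)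
    (hk : ∀ x, blk x = y → ‖k y x‖ ≤ κ) (hμ : ∀ x, blk x = y → ‖μ x‖ ≤ B) :
    ‖kerOp blk k μ y‖ ≤ (block blk y).card * κ * B := by
  rw [kerOp_apply]
  have hterm : ∀ x ∈ block blk y, ‖k y x (μ x)‖ ≤ κ * B := by
    intro x hx
    rw [mem_block] at hx
    exact (ContinuousLinearMap.le_opNorm _ _).trans (mul_le_mul (hk x hx) (hμ x hx) (norm_nonneg _) hκ)
  calc ‖∑ x ∈ block blk y, k y x (μ x)‖ ≤ ∑ x ∈ block blk y, κ * B := norm_sum_le_of_le _ hterm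
    _ = (block blk y).card * κ * B := by rw [Finset.sum_const, nsmul_eq_mul, mul_assoc]

/-- **The shape of (3.59)**: a kernel bound `|k(y, x)| ≦ C·w(y)` (print: `|L^{−jd}F′₂,ⱼ(A; y, x)| ≦ L^{−jd}·O(1)α₁`, (3.58))
gives `|(Kλ)(y)| ≦ C·Σ_{x∈B(y)} w(y)|λ(x)| = C·(Q′ⱼ|λ|)(y)` (*"|(F′₂,ⱼ(A)λ)(y)| ≦ O(1)α₁(Q′ⱼ|λ|)(y)"*, `(Q′ⱼ|λ|)(y) =
Σ_{x∈B^j(y)} L^{−jd}|λ(x)|`). [cite: Balaban1985BackgroundPropagators, (3.58)–(3.59) p.402] -/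
theorem norm_kerOp_le_avg (blk : X → S) (k : S → X → E →L[ℝ] E) (μ : X → E) (y : S) {C : ℝ} (w : S → ℝ)
    (hk : ∀ x, blk x = y → ‖k y x‖ ≤ C * w y) :
    ‖kerOp blk k μ y‖ ≤ C * ∑ x ∈ block blk y, w y * ‖μ x‖ := by
  rw [kerOp_apply, Finset.mul_sum]
  refine norm_sum_le_of_le _ fun x hx => ?_
  rw [mem_block] at hx
  calc ‖k y x (μ x)‖ ≤ ‖k y x‖ * ‖μ x‖ := ContinuousLinearMap.le_opNorm _ _
    _ ≤ C * w y * ‖μ x‖ := mul_le_mul_of_nonneg_right (hk x hx) (norm_nonneg _)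
    _ = C * (w y * ‖μ x‖) := by ring

/-- One starred term of (3.60) at a point: `|s(x)·c(y)·(Kλ)(y)| ≦ σ·|c(y)|·(|B(y)|κB)` for `|s(x)| ≦ σ`, the kernel of `K`
bounded by `κ` and `|λ| ≦ B` on the block `B(y)`, `y = y_x`. [cite: Balaban1985BackgroundPropagators, (3.60)–(3.61) p.402] -/
theorem norm_starTerm_le (blk : X → S) (s : X → E →L[ℝ] E) (k : S → X → E →L[ℝ] E) (c : S → ℝ) (μ : X → E)
    (x : X) {σ κ B : ℝ} (hσ : ‖s x‖ ≤ σ) (hκ : 0 ≤ κ) (hk : ∀ x', blk x' = blk x → ‖k (blk x) x'‖ ≤ κ)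
    (hμ : ∀ x', blk x' = blk x → ‖μ x'‖ ≤ B) :
    ‖s x (c (blk x) • kerOp blk k μ (blk x))‖ ≤ σ * (|c (blk x)| * ((block blk (blk x)).card * κ * B)) := by
  have hB : 0 ≤ B := (norm_nonneg _).trans (hμ x rfl)
  have h1 := norm_kerOp_le blk k μ (blk x) hκ hk hμ
  have h0 : 0 ≤ |c (blk x)| * ((block blk (blk x)).card * κ * B) :=
    mul_nonneg (abs_nonneg _) (mul_nonneg (mul_nonneg (Nat.cast_nonneg _) hκ) hB)
  calc ‖s x (c (blk x) • kerOp blk k μ (blk x))‖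
      ≤ ‖s x‖ * ‖c (blk x) • kerOp blk k μ (blk x)‖ := ContinuousLinearMap.le_opNorm _ _
    _ = ‖s x‖ * (|c (blk x)| * ‖kerOp blk k μ (blk x)‖) := by rw [norm_smul, Real.norm_eq_abs]
    _ ≤ σ * (|c (blk x)| * ((block blk (blk x)).card * κ * B)) :=
        mul_le_mul hσ (mul_le_mul_of_nonneg_left h1 (abs_nonneg _)) (mul_nonneg (abs_nonneg _) (norm_nonneg _))
          ((norm_nonneg _).trans hσ)

/-- **(3.61) PROVED, constants explicit** — *"It satisfies the bound |(V′(A)λ)(x)| ≦ O(1)α₁((L^jη)^{−1}|∇_Uλ| +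
(L^jη)^{−2}|λ|) (3.61) for x ∈ B^j(Λ_j), the norms on the right-hand side restricted to the block B^j(y) containing the
point x"*.  INPUTS, all of the printed shape: (3.54) for `V′₁(A)` with its O(1)'s `c₁` (= 4d) and `c₂` (= 2d + 8dα₁) over the
neighbourhood systems `N₁` (bonds) / `N₂` (sites) it involves (binder `h354`; print: *"nearest neighbours of x"*); the averaging
kernel `|L^{−jd}R(U(Γ^{(j)}_{y,x}))| ≦ w(y) := L^{−jd}` with `|B^j(y)|·w(y) ≦ 1` and `|R(·)*| ≦ 1` (unitary background: the adjoint
action is an isometry); (3.58) for `F′₂`, `F′₂*` with its O(1) =: `C`; `0 ≦ a_j ≦ a₀` (the recursion after (3.24)) and the scale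
`L^jη = len(y) > 0`.  OUTPUT: `|(V′(A)λ)(x)| ≦ c₁α₁(L^jη)^{−1}B₁ + (c₂ + a₀C(2 + Cα₁))α₁(L^jη)^{−2}B₂` whenever `|∇_Uλ| ≦ B₁`
on `N₁(x)` and `|λ| ≦ B₂` on `N₂(x)` and on the block of `x` — so O(1) = max(c₁, c₂ + a₀C(2 + Cα₁)), depending on d and the
O(1)'s of (3.54)/(3.58) only. [cite: Balaban1985BackgroundPropagators, (3.61) p.402, (3.54) p.401, (3.58) p.402] -/
theorem norm_vPrimeOp_le (V₁ : Module.End ℝ (X → E)) (blk : X → S) (kQ kF : S → X → E →L[ℝ] E)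
    (sQ sF : X → E →L[ℝ] E) (c : S → ℝ) {Y : Type*} (D : (X → E) →ₗ[ℝ] (Y → E)) (N₁ : X → Y → Prop)
    (N₂ : X → X → Prop) (len w : S → ℝ) (c₁ c₂ C α₁ a₀ : ℝ)
    (hlen : ∀ y, 0 < len y) (hw : ∀ y, 0 ≤ w y) (hcard : ∀ y, ((block blk y).card : ℝ) * w y ≤ 1)
    (hC : 0 ≤ C) (hα : 0 ≤ α₁) (ha₀ : 0 ≤ a₀)
    (h354 : ∀ (μ : X → E) (x : X) (B₁ B₂ : ℝ), (∀ b, N₁ x b → ‖D μ b‖ ≤ B₁) → (∀ x', N₂ x x' → ‖μ x'‖ ≤ B₂) →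
      ‖V₁ μ x‖ ≤ c₁ * α₁ * (len (blk x))⁻¹ * B₁ + c₂ * α₁ * (len (blk x) ^ 2)⁻¹ * B₂)
    (hkQ : ∀ y x, blk x = y → ‖kQ y x‖ ≤ w y) (hkF : ∀ y x, blk x = y → ‖kF y x‖ ≤ C * α₁ * w y)
    (hsQ : ∀ x, ‖sQ x‖ ≤ 1) (hsF : ∀ x, ‖sF x‖ ≤ C * α₁) (hc : ∀ y, |c y| ≤ a₀ * (len y ^ 2)⁻¹)
    (μ : X → E) (x : X) (B₁ B₂ : ℝ) (hB₁ : ∀ b, N₁ x b → ‖D μ b‖ ≤ B₁) (hB₂ : ∀ x', N₂ x x' → ‖μ x'‖ ≤ B₂)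
    (hB₂' : ∀ x', blk x' = blk x → ‖μ x'‖ ≤ B₂) :
    ‖vPrimeOp V₁ blk kQ kF sQ sF c μ x‖
      ≤ c₁ * α₁ * (len (blk x))⁻¹ * B₁ + (c₂ + a₀ * C * (2 + C * α₁)) * α₁ * (len (blk x) ^ 2)⁻¹ * B₂ := by
  set y := blk x with hy
  have hB : 0 ≤ B₂ := (norm_nonneg _).trans (hB₂' x rfl)
  have hCα : 0 ≤ C * α₁ := mul_nonneg hC hα
  have hℓ : 0 ≤ (len y ^ 2)⁻¹ := inv_nonneg.mpr (pow_nonneg (hlen y).le 2)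
  have hn : ((block blk y).card : ℝ) * w y ≤ 1 := hcard y
  have hn0 : 0 ≤ ((block blk y).card : ℝ) * w y := mul_nonneg (Nat.cast_nonneg _) (hw y)
  -- the three starred terms
  have hT1 : ‖sF x (c y • kerOp blk kQ μ y)‖ ≤ C * α₁ * (a₀ * (len y ^ 2)⁻¹ * B₂) := by
    have h := norm_starTerm_le blk sF kQ c μ x (hsF x) (hw y) (fun x' hx' => hkQ y x' hx') hB₂'
    refine h.trans (mul_le_mul_of_nonneg_left ?_ hCα)
    calc |c y| * (((block blk y).card : ℝ) * w y * B₂) ≤ a₀ * (len y ^ 2)⁻¹ * (1 * B₂) := by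
          refine mul_le_mul (hc y) ?_ (mul_nonneg hn0 hB) (mul_nonneg ha₀ hℓ)
          exact mul_le_mul_of_nonneg_right hn hB
      _ = a₀ * (len y ^ 2)⁻¹ * B₂ := by ring
  have hT2 : ‖sQ x (c y • kerOp blk kF μ y)‖ ≤ 1 * (a₀ * (len y ^ 2)⁻¹ * (C * α₁ * B₂)) := by
    have h := norm_starTerm_le blk sQ kF c μ x (hsQ x) (mul_nonneg hCα (hw y)) (fun x' hx' => hkF y x' hx') hB₂'
    refine h.trans (mul_le_mul_of_nonneg_left ?_ zero_le_one)
    calc |c y| * (((block blk y).card : ℝ) * (C * α₁ * w y) * B₂) ≤ a₀ * (len y ^ 2)⁻¹ * (C * α₁ * (1 * B₂)) := by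
          refine mul_le_mul (hc y) ?_ ?_ (mul_nonneg ha₀ hℓ)
          · calc ((block blk y).card : ℝ) * (C * α₁ * w y) * B₂ = C * α₁ * ((((block blk y).card : ℝ) * w y) * B₂) := by
                  ring
              _ ≤ C * α₁ * (1 * B₂) := mul_le_mul_of_nonneg_left (mul_le_mul_of_nonneg_right hn hB) hCα
          · have : 0 ≤ ((block blk y).card : ℝ) * (C * α₁ * w y) := mul_nonneg (Nat.cast_nonneg _) (mul_nonneg hCα (hw y))
            exact mul_nonneg this hB
      _ = a₀ * (len y ^ 2)⁻¹ * (C * α₁ * B₂) := by ring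
  have hT3 : ‖sF x (c y • kerOp blk kF μ y)‖ ≤ C * α₁ * (a₀ * (len y ^ 2)⁻¹ * (C * α₁ * B₂)) := by
    have h := norm_starTerm_le blk sF kF c μ x (hsF x) (mul_nonneg hCα (hw y)) (fun x' hx' => hkF y x' hx') hB₂'
    refine h.trans (mul_le_mul_of_nonneg_left ?_ hCα)
    calc |c y| * (((block blk y).card : ℝ) * (C * α₁ * w y) * B₂) ≤ a₀ * (len y ^ 2)⁻¹ * (C * α₁ * (1 * B₂)) := by
          refine mul_le_mul (hc y) ?_ ?_ (mul_nonneg ha₀ hℓ)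
          · calc ((block blk y).card : ℝ) * (C * α₁ * w y) * B₂ = C * α₁ * ((((block blk y).card : ℝ) * w y) * B₂) := by
                  ring
              _ ≤ C * α₁ * (1 * B₂) := mul_le_mul_of_nonneg_left (mul_le_mul_of_nonneg_right hn hB) hCα
          · have : 0 ≤ ((block blk y).card : ℝ) * (C * α₁ * w y) := mul_nonneg (Nat.cast_nonneg _) (mul_nonneg hCα (hw y))
            exact mul_nonneg this hB
      _ = a₀ * (len y ^ 2)⁻¹ * (C * α₁ * B₂) := by ring
  have hV₁ := h354 μ x B₁ B₂ hB₁ hB₂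
  rw [vPrimeOp_apply]
  calc ‖V₁ μ x - (sF x (c y • kerOp blk kQ μ y) + sQ x (c y • kerOp blk kF μ y) + sF x (c y • kerOp blk kF μ y))‖
      ≤ ‖V₁ μ x‖ + (‖sF x (c y • kerOp blk kQ μ y)‖ + ‖sQ x (c y • kerOp blk kF μ y)‖
          + ‖sF x (c y • kerOp blk kF μ y)‖) := by
        refine (norm_sub_le _ _).trans (add_le_add le_rfl ?_)
        exact (norm_add_le _ _).trans (add_le_add (norm_add_le _ _) le_rfl)
    _ ≤ (c₁ * α₁ * (len y)⁻¹ * B₁ + c₂ * α₁ * (len y ^ 2)⁻¹ * B₂)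
        + (C * α₁ * (a₀ * (len y ^ 2)⁻¹ * B₂) + 1 * (a₀ * (len y ^ 2)⁻¹ * (C * α₁ * B₂))
          + C * α₁ * (a₀ * (len y ^ 2)⁻¹ * (C * α₁ * B₂))) := add_le_add hV₁ (add_le_add (add_le_add hT1 hT2) hT3)
    _ = c₁ * α₁ * (len y)⁻¹ * B₁ + (c₂ + a₀ * C * (2 + C * α₁)) * α₁ * (len y ^ 2)⁻¹ * B₂ := by ring

end BlockModel


/-! ## §4 Existence of `G′(U′U)` on the finite lattice: (3.63)-majorant + Lemma 2.1 ⟹ sup-operator norm < 1 ⟹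
(3.64)/(3.65) for endomorphisms of `X → ℝ` (discharging `h365`/`hS` of `B9Thm34Ext`) -/

section FiniteLattice

variable {X : Type} [Fintype X]

/-- An endomorphism of the finite function space `X → ℝ` (sup norm) as a bounded operator — the Banach algebra in which
the Neumann series (3.64) is summed (*"the inverse is given by a convergent Neumann series"*).
[cite: Balaban1985BackgroundPropagators, (3.64) p.402] -/
noncomputable def toCLM (T : Module.End ℝ (X → ℝ)) : (X → ℝ) →L[ℝ] (X → ℝ) := LinearMap.toContinuousLinearMap T

/-- `toCLM T` acts as `T`. [cite: Balaban1985BackgroundPropagators, (3.64) p.402] -/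
@[simp] theorem toCLM_apply (T : Module.End ℝ (X → ℝ)) (μ : X → ℝ) : toCLM T μ = T μ := rfl

/-- `toCLM` is multiplicative (composition). [cite: Balaban1985BackgroundPropagators, (3.64) p.402] -/
theorem toCLM_mul (T₁ T₂ : Module.End ℝ (X → ℝ)) : toCLM (T₁ * T₂) = toCLM T₁ * toCLM T₂ := by
  ext μ x
  rfl

/-- `toCLM 1 = 1`. [cite: Balaban1985BackgroundPropagators, (3.64) p.402] -/
theorem toCLM_one : toCLM (1 : Module.End ℝ (X → ℝ)) = 1 := by
  ext μ x
  rfl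

/-- *"or the bound |V′(A)G′(U)λ|_{(γ)} ≦ O(1)B₀α₁|λ|_{(γ)}"* (γ = 0: sup norms): a pointwise bound `|(Tλ)(x)| ≦ κ‖λ‖_∞` for
all `λ, x` is an operator-norm bound `‖T‖ ≦ κ` in the sup norm. [cite: Balaban1985BackgroundPropagators, (3.63) p.402] -/
theorem opNorm_toCLM_le (T : Module.End ℝ (X → ℝ)) {κ : ℝ} (hκ : 0 ≤ κ)
    (hT : ∀ (μ : X → ℝ) (x : X), |T μ x| ≤ κ * ‖μ‖) : ‖toCLM T‖ ≤ κ := by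
  refine ContinuousLinearMap.opNorm_le_bound _ hκ fun μ => ?_
  rw [toCLM_apply, pi_norm_le_iff_of_nonneg (mul_nonneg hκ (norm_nonneg _))]
  intro x
  rw [Real.norm_eq_abs]
  exact hT μ x

variable {g : B6.Geometry}

/-- **Block majorant ⟹ sup-norm bound.**  If `T` has the block majorant `K ≧ 0` (`|(Tλ)(x)| ≦ K(y, y′)|λ|` for `x` in the
block of `y`, `supp λ ⊂ Δ(y′)`), then for an ARBITRARY `λ` (decomposed into its block pieces)
`|(Tλ)(x)| ≦ (Σ_{y′} K(y_x, y′))·‖λ‖_∞`. [cite: Balaban1985BackgroundPropagators, (3.63) p.402] -/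
theorem abs_apply_le_rowSum_of_hasMajorant (blk : X → g.Site) {T : Module.End ℝ (X → ℝ)}
    {K : g.Site → g.Site → ℝ} (hK : B6RandomWalk.HasMajorant blk T K) (μ : X → ℝ) (x : X) :
    |T μ x| ≤ (∑ y' : g.Site, K (blk x) y') * ‖μ‖ := by
  have hpiece : ∀ y' : g.Site, |T (B6RandomWalk.blockPiece blk y' μ) x| ≤ K (blk x) y' * ‖μ‖ := fun y' =>
    hK y' _ _ (B6RandomWalk.blockSupp_blockPiece blk μ y' ‖μ‖ (norm_nonneg _)
      (fun x' _ => by rw [← Real.norm_eq_abs]; exact norm_le_pi_norm μ x')) x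
  conv_lhs => rw [← B6RandomWalk.sum_blockPiece blk μ, map_sum, Finset.sum_apply]
  rw [Finset.sum_mul]
  exact (Finset.abs_sum_le_sum_abs _ _).trans (Finset.sum_le_sum fun y' _ => hpiece y')

/-- **(3.63) + Lemma 2.1 of [4] ⟹ the sup-operator norm of `V′(A)G′(U)` is `≦ θc₁(α)`** (*"Thus for α₁ sufficiently small
the norm of this operator is small"*): the (3.63)-majorant `θe^{−δ₀d(y,y′)}` has row sums `≦ θΣ_{y′}e^{−αδ₀d(y,y′)} ≦ θc₁(α)`
by (2.61) of [4] (binder `Ineq261`, as in `B9Thm34Ext`), for `0 ≦ (1 − α)δ₀`, `d ≧ 0`, `θ ≧ 0`.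
[cite: Balaban1985BackgroundPropagators, (3.63) p.402; Balaban1984PropagatorsII, Lemma 2.1 (2.61) p.234] -/
theorem opBound_of_363_261 (blk : X → g.Site) (d : ℕ) (δ₀ α θ : ℝ) (hθ : 0 ≤ θ) (hαδ : 0 ≤ (1 - α) * δ₀)
    (hdnn : ∀ y y' : g.Site, 0 ≤ g.dist y y') (h261 : B6RandomWalk.Ineq261 d g δ₀ α)
    {W : Module.End ℝ (X → ℝ)}
    (h363 : B6RandomWalk.HasMajorant blk W (fun a b => θ * Real.exp (-(δ₀ * g.dist a b)))) :
    ∀ (μ : X → ℝ) (x : X), |W μ x| ≤ θ * B6.c1 d δ₀ α * ‖μ‖ := by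
  intro μ x
  refine (abs_apply_le_rowSum_of_hasMajorant blk h363 μ x).trans (mul_le_mul_of_nonneg_right ?_ (norm_nonneg _))
  rw [← Finset.mul_sum]
  refine mul_le_mul_of_nonneg_left ((Finset.sum_le_sum fun y' _ => ?_).trans (h261 (blk x))) hθ
  refine Real.exp_le_exp.mpr ?_
  have := mul_nonneg hαδ (hdnn (blk x) y')
  nlinarith

/-- … hence `‖V′(A)G′(U)‖ ≦ θc₁(α)` as a bounded operator on `(X → ℝ, ‖·‖_∞)`, and `< 1` under the smallness `θc₁(α) < 1` of
`B9Thm34Ext` (*"for α₁ sufficiently small"*, θ = O(1)B₀α₁). [cite: Balaban1985BackgroundPropagators, (3.63)–(3.64) p.402] -/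
theorem opNorm_lt_one_of_363_261 (blk : X → g.Site) (d : ℕ) (δ₀ α θ : ℝ) (hθ : 0 ≤ θ) (hαδ : 0 ≤ (1 - α) * δ₀)
    (hdnn : ∀ y y' : g.Site, 0 ≤ g.dist y y') (h261 : B6RandomWalk.Ineq261 d g δ₀ α)
    (hsmall : θ * B6.c1 d δ₀ α < 1) {W : Module.End ℝ (X → ℝ)}
    (h363 : B6RandomWalk.HasMajorant blk W (fun a b => θ * Real.exp (-(δ₀ * g.dist a b)))) :
    ‖toCLM W‖ < 1 := by
  have hc : 0 ≤ θ * B6.c1 d δ₀ α := mul_nonneg hθ (B6RandomWalk.c1_nonneg d δ₀ α)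
  exact lt_of_le_of_lt (opNorm_toCLM_le W hc (opBound_of_363_261 blk d δ₀ α θ hθ hαδ hdnn h261 h363)) hsmall

/-- In a complete normed ring: `GΣ_nWⁿ = G + (GΣ_nWⁿ)W` for `‖W‖ < 1` (the algebra of (3.65)₂ with `W = V′(A)G′(U)` kept
as ONE letter, as in the binder `h365 : GpExt = GpU + GpExt * V` of `B9Thm34Ext`). [cite: Balaban1985BackgroundPropagators, (3.65) p.402] -/
theorem mul_geom_series_eq {A : Type*} [NormedRing A] [CompleteSpace A] (Gc Wc : A) (h : ‖Wc‖ < 1) :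
    Gc * ∑' n : ℕ, Wc ^ n = Gc + (Gc * ∑' n : ℕ, Wc ^ n) * Wc := by
  have e := geom_series_mul_neg Wc h
  have e' : ∑' i : ℕ, Wc ^ i = 1 + (∑' i : ℕ, Wc ^ i) * Wc := by
    rw [mul_sub, mul_one, sub_eq_iff_eq_add] at e
    exact e
  calc Gc * ∑' n : ℕ, Wc ^ n = Gc * (1 + (∑' i : ℕ, Wc ^ i) * Wc) := by rw [← e']
    _ = Gc + Gc * (∑' n : ℕ, Wc ^ n) * Wc := by noncomm_ring

/-- **`G′(U′U)` on the finite lattice, as a bounded operator**: the series (3.64) `G′(U)Σ_nWⁿ` (`W` = the operator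
`V′(A)G′(U)`), summed in the operator norm of `(X → ℝ, ‖·‖_∞)`. [cite: Balaban1985BackgroundPropagators, (3.64) p.402] -/
noncomputable def gPrimeExtCLM (GpU W : Module.End ℝ (X → ℝ)) : (X → ℝ) →L[ℝ] (X → ℝ) :=
  toCLM GpU * ∑' n : ℕ, toCLM W ^ n

/-- **`G′(U′U)` on the finite lattice, as a linear map** (the carrier of `B6RandomWalk.HasMajorant` and of the binders
`GpExt` of `B9Thm34Ext` / `B6RandomWalkHom`). [cite: Balaban1985BackgroundPropagators, (3.64) p.402] -/
noncomputable def gPrimeExtEnd (GpU W : Module.End ℝ (X → ℝ)) : Module.End ℝ (X → ℝ) :=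
  (gPrimeExtCLM GpU W : (X → ℝ) →ₗ[ℝ] (X → ℝ))

/-- `gPrimeExtEnd` acts as the operator series. [cite: Balaban1985BackgroundPropagators, (3.64) p.402] -/
@[simp] theorem gPrimeExtEnd_apply (GpU W : Module.End ℝ (X → ℝ)) (μ : X → ℝ) :
    gPrimeExtEnd GpU W μ = gPrimeExtCLM GpU W μ := rfl

/-- `toCLM (gPrimeExtEnd GpU W) = gPrimeExtCLM GpU W`. [cite: Balaban1985BackgroundPropagators, (3.64) p.402] -/
theorem toCLM_gPrimeExtEnd (GpU W : Module.End ℝ (X → ℝ)) : toCLM (gPrimeExtEnd GpU W) = gPrimeExtCLM GpU W := by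
  ext μ x
  rfl

/-- `toCLM` is injective (it does not change the underlying map). [cite: Balaban1985BackgroundPropagators, (3.64) p.402] -/
theorem eq_of_toCLM_eq {T₁ T₂ : Module.End ℝ (X → ℝ)} (h : toCLM T₁ = toCLM T₂) : T₁ = T₂ := by
  apply LinearMap.ext
  intro μ
  have := congrArg (fun f : (X → ℝ) →L[ℝ] (X → ℝ) => f μ) h
  exact this

/-- `toCLM` is additive. [cite: Balaban1985BackgroundPropagators, (3.64) p.402] -/
theorem toCLM_add (T₁ T₂ : Module.End ℝ (X → ℝ)) : toCLM (T₁ + T₂) = toCLM T₁ + toCLM T₂ := by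
  ext μ x
  rfl

/-- `toCLM` respects subtraction. [cite: Balaban1985BackgroundPropagators, (3.64) p.402] -/
theorem toCLM_sub (T₁ T₂ : Module.End ℝ (X → ℝ)) : toCLM (T₁ - T₂) = toCLM T₁ - toCLM T₂ := by
  ext μ x
  rfl

/-- **(3.65), second form, on the finite lattice — the binder `h365` of `B9Thm34Ext.gpExt_entry1_of_365` DISCHARGED**:
for `‖W‖_{∞→∞} < 1`, `G′(U′U) = G′(U) + G′(U′U)W` with `G′(U′U) := G′(U)Σ_nWⁿ`.
[cite: Balaban1985BackgroundPropagators, (3.65) p.402] -/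
theorem eq365_end (GpU W : Module.End ℝ (X → ℝ)) (hW : ‖toCLM W‖ < 1) :
    gPrimeExtEnd GpU W = GpU + gPrimeExtEnd GpU W * W := by
  apply eq_of_toCLM_eq
  rw [toCLM_add, toCLM_mul, toCLM_gPrimeExtEnd, gPrimeExtCLM]
  exact mul_geom_series_eq (toCLM GpU) (toCLM W) hW

/-- (3.65), first form, on the finite lattice, for `W = V′(A)G′(U)`: `G′(U′U) = G′(U) + G′(U)V′(A)G′(U′U)`.
[cite: Balaban1985BackgroundPropagators, (3.65) p.402] -/
theorem eq365_end_left (GpU Vp : Module.End ℝ (X → ℝ)) (hW : ‖toCLM (Vp * GpU)‖ < 1) :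
    gPrimeExtEnd GpU (Vp * GpU) = GpU + GpU * Vp * gPrimeExtEnd GpU (Vp * GpU) := by
  apply eq_of_toCLM_eq
  rw [toCLM_mul] at hW
  rw [toCLM_add, toCLM_mul, toCLM_mul, toCLM_gPrimeExtEnd, gPrimeExtCLM, toCLM_mul]
  exact eq365_left (toCLM GpU) (toCLM Vp) hW

/-- *"This implies the existence of the operator G′(U′U)"* on the finite lattice, right-inverse half: with
`Δ′ := Δ_U + Q′*(U)aQ′(U)` and `Δ′G′(U) = 1`, `(Δ′ − V′(A))·G′(U′U) = 1` for `‖V′(A)G′(U)‖_{∞→∞} < 1`.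
[cite: Balaban1985BackgroundPropagators, (3.62)–(3.64) p.402] -/
theorem deltaSub_mul_gPrimeExtEnd (Δp Vp GpU : Module.End ℝ (X → ℝ)) (hΔG : Δp * GpU = 1)
    (hW : ‖toCLM (Vp * GpU)‖ < 1) : (Δp - Vp) * gPrimeExtEnd GpU (Vp * GpU) = 1 := by
  apply eq_of_toCLM_eq
  rw [toCLM_mul] at hW
  have hΔG' : toCLM Δp * toCLM GpU = 1 := by rw [← toCLM_mul, hΔG, toCLM_one]
  rw [toCLM_mul, toCLM_sub, toCLM_gPrimeExtEnd, gPrimeExtCLM, toCLM_mul, toCLM_one]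
  exact deltaSub_mul_gPrimeExt (toCLM Δp) (toCLM Vp) (toCLM GpU) hΔG' hW

/-- … left-inverse half: with `G′(U)Δ′ = 1`, `G′(U′U)·(Δ′ − V′(A)) = 1`. [cite: Balaban1985BackgroundPropagators, (3.62)–(3.64) p.402] -/
theorem gPrimeExtEnd_mul_deltaSub (Δp Vp GpU : Module.End ℝ (X → ℝ)) (hGΔ : GpU * Δp = 1)
    (hW : ‖toCLM (Vp * GpU)‖ < 1) : gPrimeExtEnd GpU (Vp * GpU) * (Δp - Vp) = 1 := by
  apply eq_of_toCLM_eq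
  rw [toCLM_mul] at hW
  have hGΔ' : toCLM GpU * toCLM Δp = 1 := by rw [← toCLM_mul, hGΔ, toCLM_one]
  rw [toCLM_mul, toCLM_sub, toCLM_gPrimeExtEnd, gPrimeExtCLM, toCLM_mul, toCLM_one]
  exact gPrimeExt_mul_deltaSub (toCLM Δp) (toCLM Vp) (toCLM GpU) hGΔ' hW

/-- **Existence of `G′(U′U)` from the PRINTED-SHAPE inputs** (finite lattice): the (3.63)-majorant `θe^{−δ₀d}` of
`V′(A)G′(U)`, Lemma 2.1 of [4] and the smallness `θc₁(α) < 1` give an operator `G′(U′U)` with BOTH identities (3.65)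
and, when `G′(U)` is the two-sided inverse of `Δ′ = Δ_U + Q′*(U)aQ′(U)`, the two-sided inverse property for
`Δ_{U′U} + Q′*(U′U)aQ′(U′U) = Δ′ − V′(A)`. [cite: Balaban1985BackgroundPropagators, (3.62)–(3.65) p.402] -/
theorem exists_gPrimeExt_of_363 (blk : X → g.Site) (d : ℕ) (δ₀ α θ : ℝ) (hθ : 0 ≤ θ) (hαδ : 0 ≤ (1 - α) * δ₀)
    (hdnn : ∀ y y' : g.Site, 0 ≤ g.dist y y') (h261 : B6RandomWalk.Ineq261 d g δ₀ α)
    (hsmall : θ * B6.c1 d δ₀ α < 1) (Δp GpU Vp : Module.End ℝ (X → ℝ)) (hΔG : Δp * GpU = 1) (hGΔ : GpU * Δp = 1)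
    (h363 : B6RandomWalk.HasMajorant blk (Vp * GpU) (fun a b => θ * Real.exp (-(δ₀ * g.dist a b)))) :
    ∃ GpExt : Module.End ℝ (X → ℝ),
      GpExt = GpU + GpU * Vp * GpExt ∧ GpExt = GpU + GpExt * (Vp * GpU)
        ∧ (Δp - Vp) * GpExt = 1 ∧ GpExt * (Δp - Vp) = 1 := by
  have hW := opNorm_lt_one_of_363_261 blk d δ₀ α θ hθ hαδ hdnn h261 hsmall h363
  exact ⟨gPrimeExtEnd GpU (Vp * GpU), eq365_end_left GpU Vp hW, eq365_end GpU (Vp * GpU) hW,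
    deltaSub_mul_gPrimeExtEnd Δp Vp GpU hΔG hW, gPrimeExtEnd_mul_deltaSub Δp Vp GpU hGΔ hW⟩

end FiniteLattice

/-! ## §5 Bridges: the cell's B9-side theorems with their (3.61)/(3.65) binders discharged -/

section Bridges

open B9Thm34Ext B6RandomWalk B6RandomWalkHom

variable {g : B9.Geometry} [Fintype g.Site] {R : ℝ} {H : Prop} {X Y : Type}

omit [Fintype g.Site] in
/-- **(3.61) in EXACTLY the binder shape `h361` of `B6RandomWalkHom.b9_363_of_361`** (scalar block model of the cell's B9
files: `E = ℝ`, averaging sites = `g.Site`, `L^jη = g.len y`): when the input norms of the (3.54)-bound of `V′₁` are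
block-restricted (bonds `b` with `blkY b = blkX x`, sites `x′` with `blkX x′ = blkX x` — the print's *"restricted to the block
B^j(y) containing the point x"*, READING NOTE T9), `V′(A) = vPrimeOp …` satisfies `h361` with `c₁′ = c₁`,
`c₂′ = c₂ + a₀C(2 + Cα₁)`. [cite: Balaban1985BackgroundPropagators, (3.61) p.402] -/
theorem ineq361_blockForm [Fintype X] [DecidableEq g.Site] (blkX : X → g.Site) (blkY : Y → g.Site)
    (V₁ : Module.End ℝ (X → ℝ)) (D : (X → ℝ) →ₗ[ℝ] (Y → ℝ)) (kQ kF : g.Site → X → ℝ →L[ℝ] ℝ)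
    (sQ sF : X → ℝ →L[ℝ] ℝ) (c w : g.Site → ℝ) (c₁ c₂ C α₁ a₀ : ℝ)
    (hlen : ∀ y : g.Site, 0 < g.len y) (hw : ∀ y, 0 ≤ w y) (hcard : ∀ y, ((block blkX y).card : ℝ) * w y ≤ 1)
    (hC : 0 ≤ C) (hα : 0 ≤ α₁) (ha₀ : 0 ≤ a₀)
    (h354 : ∀ (μ : X → ℝ) (x : X) (B₁ B₂ : ℝ), (∀ b : Y, blkY b = blkX x → |D μ b| ≤ B₁) →
      (∀ x' : X, blkX x' = blkX x → |μ x'| ≤ B₂) →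
      |V₁ μ x| ≤ c₁ * α₁ * (g.len (blkX x))⁻¹ * B₁ + c₂ * α₁ * (g.len (blkX x) ^ 2)⁻¹ * B₂)
    (hkQ : ∀ y x, blkX x = y → ‖kQ y x‖ ≤ w y) (hkF : ∀ y x, blkX x = y → ‖kF y x‖ ≤ C * α₁ * w y)
    (hsQ : ∀ x, ‖sQ x‖ ≤ 1) (hsF : ∀ x, ‖sF x‖ ≤ C * α₁) (hc : ∀ y, |c y| ≤ a₀ * (g.len y ^ 2)⁻¹) :
    ∀ (μ : X → ℝ) (x : X) (B₁ B₂ : ℝ), (∀ b : Y, blkY b = blkX x → |D μ b| ≤ B₁) →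
      (∀ x' : X, blkX x' = blkX x → |μ x'| ≤ B₂) →
      |vPrimeOp V₁ blkX kQ kF sQ sF c μ x|
        ≤ c₁ * α₁ * (g.len (blkX x))⁻¹ * B₁ + (c₂ + a₀ * C * (2 + C * α₁)) * α₁ * (g.len (blkX x) ^ 2)⁻¹ * B₂ := by
  intro μ x B₁ B₂ hB₁ hB₂
  have h354' : ∀ (μ : X → ℝ) (x : X) (B₁ B₂ : ℝ), (∀ b : Y, blkY b = blkX x → ‖D μ b‖ ≤ B₁) →
      (∀ x' : X, blkX x' = blkX x → ‖μ x'‖ ≤ B₂) →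
      ‖V₁ μ x‖ ≤ c₁ * α₁ * (g.len (blkX x))⁻¹ * B₁ + c₂ * α₁ * (g.len (blkX x) ^ 2)⁻¹ * B₂ := by
    intro μ x B₁ B₂ h1 h2
    rw [Real.norm_eq_abs]
    exact h354 μ x B₁ B₂ (fun b hb => by rw [← Real.norm_eq_abs]; exact h1 b hb)
      (fun x' hx' => by rw [← Real.norm_eq_abs]; exact h2 x' hx')
  have h := norm_vPrimeOp_le V₁ blkX kQ kF sQ sF c D (fun x b => blkY b = blkX x) (fun x x' => blkX x' = blkX x)
    g.len w c₁ c₂ C α₁ a₀ hlen hw hcard hC hα ha₀ h354' hkQ hkF hsQ hsF hc μ x B₁ B₂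
    (fun b hb => by rw [Real.norm_eq_abs]; exact hB₁ b hb) (fun x' hx' => by rw [Real.norm_eq_abs]; exact hB₂ x' hx')
    (fun x' hx' => by rw [Real.norm_eq_abs]; exact hB₂ x' hx')
  rw [← Real.norm_eq_abs]
  exact h

/-- **(3.63) from (3.54), (3.58) and (3.42)₁,₂** — `B6RandomWalkHom.b9_363_of_361` with its binder `h361` DISCHARGED by
`ineq361_blockForm`: if `V′₁(A)` obeys the (3.54)-shape block bound (constants `c₁, c₂`), the averaging kernels obey
`|L^{−jd}R(U(Γ))| ≦ w`, `|B^j(y)|w ≦ 1`, `|R(·)*| ≦ 1`, the (3.58)-shape bounds hold with constant `C`, `0 ≦ a_j ≦ a₀`, and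
`G′(U)` has the (3.42)₁,₂-majorants, then `V′(A)G′(U)` has the (3.63)-majorant `(c₁ + c₂ + a₀C(2 + Cα₁))B₀α₁e^{−δ₀d(y,y′)}`
(θ = κ₀B₀α₁ with κ₀ EXPLICIT). [cite: Balaban1985BackgroundPropagators, (3.61)–(3.63) p.402, (3.42) p.397] -/
theorem b9_363_of_354_358 [Fintype X] [DecidableEq g.Site] (blkX : X → g.Site) (blkY : Y → g.Site)
    (δ₀ B₀ α₁ : ℝ) (V₁ : Module.End ℝ (X → ℝ)) (D : (X → ℝ) →ₗ[ℝ] (Y → ℝ)) {Gp : Module.End ℝ (X → ℝ)}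
    (kQ kF : g.Site → X → ℝ →L[ℝ] ℝ) (sQ sF : X → ℝ →L[ℝ] ℝ) (c w : g.Site → ℝ) (c₁ c₂ C a₀ : ℝ)
    (hlen : ∀ y : g.Site, 0 < g.len y) (hw : ∀ y, 0 ≤ w y) (hcard : ∀ y, ((block blkX y).card : ℝ) * w y ≤ 1)
    (hC : 0 ≤ C) (hα : 0 ≤ α₁) (ha₀ : 0 ≤ a₀)
    (h354 : ∀ (μ : X → ℝ) (x : X) (B₁ B₂ : ℝ), (∀ b : Y, blkY b = blkX x → |D μ b| ≤ B₁) →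
      (∀ x' : X, blkX x' = blkX x → |μ x'| ≤ B₂) →
      |V₁ μ x| ≤ c₁ * α₁ * (g.len (blkX x))⁻¹ * B₁ + c₂ * α₁ * (g.len (blkX x) ^ 2)⁻¹ * B₂)
    (hkQ : ∀ y x, blkX x = y → ‖kQ y x‖ ≤ w y) (hkF : ∀ y x, blkX x = y → ‖kF y x‖ ≤ C * α₁ * w y)
    (hsQ : ∀ x, ‖sQ x‖ ≤ 1) (hsF : ∀ x, ‖sF x‖ ≤ C * α₁) (hc : ∀ y, |c y| ≤ a₀ * (g.len y ^ 2)⁻¹)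
    (h342_1 : HasMajorant (g := toB6 g R H) blkX Gp
      (fun a b => B₀ * g.len a ^ 2 * Real.exp (-(δ₀ * g.dist a b))))
    (h342_2 : HasMajorantHom (g := toB6 g R H) blkX blkY (D ∘ₗ Gp)
      (fun a b => B₀ * g.len a * Real.exp (-(δ₀ * g.dist a b)))) :
    HasMajorant (g := toB6 g R H) blkX (vPrimeOp V₁ blkX kQ kF sQ sF c * Gp)
      (fun a b => (c₁ + (c₂ + a₀ * C * (2 + C * α₁))) * B₀ * α₁ * Real.exp (-(δ₀ * g.dist a b))) :=
  b9_363_of_361 (R := R) (H := H) blkX blkY δ₀ B₀ α₁ c₁ (c₂ + a₀ * C * (2 + C * α₁)) hlen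
    (ineq361_blockForm blkX blkY V₁ D kQ kF sQ sF c w c₁ c₂ C α₁ a₀ hlen hw hcard hC hα ha₀ h354 hkQ hkF hsQ hsF hc)
    h342_1 h342_2

/-- **Theorem 3.1's first inequality for `G′(U′U)`, with the binder `h365` of `B9Thm34Ext.gpExt_entry1_of_365` DISCHARGED**
(finite lattice): from (3.42)₁ for `G′(U)` (majorant `B₀P(y)e^{−δ₀d}`), the (3.63)-majorant `θe^{−δ₀d}` of `W = V′(A)G′(U)`,
Lemma 2.1 of [4] ((2.61)/(2.63) binders) and `θc₁(α) < 1`, the operator `G′(U′U) := G′(U)Σ_nWⁿ` — which EXISTS and satisfies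
(3.65) by §4 — obeys `|(G′(U′U)λ)(x)| ≦ B₀c₁(α)(1 − θc₁(α))^{−1}P(y)e^{−(1−α)δ₀d(y,y′)}|λ|`.
[cite: Balaban1985BackgroundPropagators, Thm 3.4 p.400, (3.62)–(3.65) pp.402–403] -/
theorem gpExt_entry1_of_363 [Fintype X] [DecidableEq X] (blk : X → g.Site) (d : ℕ) (δ₀ α θ B₀ : ℝ) (P : g.Site → ℝ)
    (hB₀ : 0 ≤ B₀) (hP : ∀ y, 0 ≤ P y) (hθ : 0 ≤ θ) (hαδ : 0 ≤ (1 - α) * δ₀)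
    (htri : Triangle254 (toB6 g R H)) (hrefl : ∀ y : g.Site, g.dist y y = 0)
    (hdnn : ∀ y y' : g.Site, 0 ≤ g.dist y y') (h261 : Ineq261 d (toB6 g R H) δ₀ α)
    (h263 : Ineq263 d (toB6 g R H) δ₀ α) (hsmall : θ * B6.c1 d δ₀ α < 1)
    {GpU W : Module.End ℝ (X → ℝ)}
    (h342 : HasMajorant (g := toB6 g R H) blk GpU (fun a b => B₀ * P a * Real.exp (-(δ₀ * g.dist a b))))
    (h363 : HasMajorant (g := toB6 g R H) blk W (fun a b => θ * Real.exp (-(δ₀ * g.dist a b)))) :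
    HasMajorant (g := toB6 g R H) blk (gPrimeExtEnd GpU W)
      (fun a b => B₀ * B6.c1 d δ₀ α * (1 - θ * B6.c1 d δ₀ α)⁻¹ * P a *
        Real.exp (-((1 - α) * δ₀ * g.dist a b))) :=
  gpExt_entry1_of_365 (R := R) (H := H) blk d δ₀ α θ B₀ P hB₀ hP hθ hαδ htri hrefl hdnn h261 h263 hsmall h342 h363
    (eq365_end GpU W (opNorm_lt_one_of_363_261 (g := toB6 g R H) blk d δ₀ α θ hθ hαδ hdnn h261 hsmall h363))

end Bridges


/-! ## §6 (v1.1) The expansion of `Q′(U′U)G′²(U′U)Q′*(U′U)` on p. 403 (the display numbered (3.65) a second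
time in print; SKELETON row B9.Eq3.66): `C′(A)` DEFINED and the seven-term identity PROVED from (3.57) and (3.65) -/

section CPrime

variable {R : Type*} [Ring R]

/-- **`C′(A)`, DEFINED by the last equality of the p. 403 display** (*"where the operator C′(A) is defined by the last
equality"*): `C′(A) := F′₂(A)G′²(U′U)Q′*(U) + Q′(U)G′²(U′U)F′₂*(A) + F′₂(A)G′²(U′U)F′₂*(A) + Q′(U)G′(U′U)V′(A)G′²(U)Q′*(U)
+ Q′(U)G′²(U)V′(A)G′(U′U)Q′*(U) + Q′(U)G′(U)V′(A)G′²(U′U)V′(A)G′(U)Q′*(U)` — letters `Q = Q′(U)`, `Qs = Q′*(U)`,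
`F₂ = F′₂(A)`, `F₂s = F′₂*(A)`, `G = G′(U)`, `E = G′(U′U)`, `V = V′(A)`.  (In `B9Thm34Inv` this operator is the binder
`Cp` with `h365 : L′ = L + Cp`; here it is the printed sum.) [cite: Balaban1985BackgroundPropagators, (3.65)–(3.66) p.403] -/
def cPrime (Q Qs F₂ F₂s G E V : R) : R :=
  F₂ * (E * E) * Qs + Q * (E * E) * F₂s + F₂ * (E * E) * F₂s + Q * (E * V * (G * G)) * Qs
    + Q * (G * G * V * E) * Qs + Q * (G * V * (E * E) * V * G) * Qs

/-- `G′²(U′U) = G′²(U) + G′(U′U)V′(A)G′²(U) + G′²(U)V′(A)G′(U′U) + G′(U)V′(A)G′²(U′U)V′(A)G′(U)` — the square of the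
extended propagator expanded by the two resolvent identities (3.65) (`E − G = EVG = GVE`, so
`E² − G² = (E − G)G + G(E − G) + (E − G)² = EVG·G + G·GVE + GVE·EVG`). [cite: Balaban1985BackgroundPropagators, (3.65) pp.402–403] -/
theorem sq_ext_expand (G E V : R) (h365l : E = G + G * V * E) (h365r : E = G + E * V * G) :
    E * E = G * G + E * V * (G * G) + G * G * V * E + G * V * (E * E) * V * G := by
  -- X := E − G has the two printed forms
  have hXr : E - G = E * V * G := by
    calc E - G = (G + E * V * G) - G := by rw [← h365r]
      _ = E * V * G := by abel
  have hXl : E - G = G * V * E := by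
    calc E - G = (G + G * V * E) - G := by rw [← h365l]
      _ = G * V * E := by abel
  have key : E * E = G * G + (E - G) * G + G * (E - G) + (E - G) * (E - G) := by noncomm_ring
  have h1 : (E - G) * G = (E * V * G) * G := by rw [hXr]
  have h2 : G * (E - G) = G * (G * V * E) := by rw [hXl]
  have h3 : (E - G) * (E - G) = (G * V * E) * (E * V * G) := by
    conv_lhs => arg 2; rw [hXr]
    conv_lhs => arg 1; rw [hXl]
  conv_lhs => rw [key, h3, h1, h2]
  noncomm_ring

/-- **The p. 403 expansion (printed with the label (3.65)), PROVED**: with (3.57) `Q′(U′U) = Q′(U) + F′₂(A)`,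
`Q′*(U′U) = Q′*(U) + F′₂*(A)` and both forms of (3.65) for `E = G′(U′U)`,
`Q′(U′U)G′²(U′U)Q′*(U′U) = Q′(U)G′²(U)Q′*(U) + C′(A)`. [cite: Balaban1985BackgroundPropagators, (3.65)–(3.66) p.403] -/
theorem eq365b (Q Q' Qs Qs' F₂ F₂s G E V : R) (h357 : Q' = Q + F₂) (h357s : Qs' = Qs + F₂s)
    (h365l : E = G + G * V * E) (h365r : E = G + E * V * G) :
    Q' * (E * E) * Qs' = Q * (G * G) * Qs + cPrime Q Qs F₂ F₂s G E V := by
  have hsq := sq_ext_expand G E V h365l h365r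
  -- expand the two outer factors first, then the square in the `Q … Qs` term only
  have h1 : Q' * (E * E) * Qs' = Q * (E * E) * Qs + F₂ * (E * E) * Qs + Q * (E * E) * F₂s + F₂ * (E * E) * F₂s := by
    rw [h357, h357s]; noncomm_ring
  rw [h1, cPrime]
  have h2 : Q * (E * E) * Qs = Q * (G * G) * Qs + Q * (E * V * (G * G)) * Qs + Q * (G * G * V * E) * Qs
      + Q * (G * V * (E * E) * V * G) * Qs := by
    conv_lhs => rw [hsq]
    noncomm_ring
  rw [h2]
  abel

/-- **(3.67), first line, with `C′(A)` the PRINTED sum**: `Q′(U′U)G′²(U′U)Q′*(U′U) = (I + C′(A)(Q′G′²Q′*)^{−1})·Q′G′²Q′*`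
given the left-inverse property `(Q′G′²Q′*)^{−1}·(Q′G′²Q′*) = 1` (the inverse of Theorem 3.2) — `B9Thm34Inv.factor_367`'s
algebra with its binder `h365` discharged by `eq365b`. [cite: Balaban1985BackgroundPropagators, (3.67) p.403] -/
theorem eq367_factor (Q Q' Qs Qs' F₂ F₂s G E V Linv : R) (h357 : Q' = Q + F₂) (h357s : Qs' = Qs + F₂s)
    (h365l : E = G + G * V * E) (h365r : E = G + E * V * G) (hinv : Linv * (Q * (G * G) * Qs) = 1) :
    Q' * (E * E) * Qs' = (1 + cPrime Q Qs F₂ F₂s G E V * Linv) * (Q * (G * G) * Qs) := by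
  rw [eq365b Q Q' Qs Qs' F₂ F₂s G E V h357 h357s h365l h365r, add_mul, one_mul,
    mul_assoc (cPrime Q Qs F₂ F₂s G E V) Linv (Q * (G * G) * Qs), hinv, mul_one]

/-- In a complete normed ring the two forms of (3.65) hold for `E = G′(U′U) := gPrimeExt G′(U) V′(A)` (§3), so the p. 403
expansion holds for THE extended operators: `Q′(U′U)·G′(U′U)²·Q′*(U′U) = Q′G′²Q′* + C′(A)` with `G′(U′U)` the Neumann series
(3.64). [cite: Balaban1985BackgroundPropagators, (3.64)–(3.66) pp.402–403] -/
theorem eq365b_gPrimeExt {A : Type*} [NormedRing A] [CompleteSpace A] (Q Q' Qs Qs' F₂ F₂s Gp Vp : A)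
    (h357 : Q' = Q + F₂) (h357s : Qs' = Qs + F₂s) (h : ‖Vp * Gp‖ < 1) :
    Q' * (gPrimeExt Gp Vp * gPrimeExt Gp Vp) * Qs'
      = Q * (Gp * Gp) * Qs + cPrime Q Qs F₂ F₂s Gp (gPrimeExt Gp Vp) Vp :=
  eq365b Q Q' Qs Qs' F₂ F₂s Gp (gPrimeExt Gp Vp) Vp h357 h357s (eq365_left Gp Vp h) (eq365_right Gp Vp h)

end CPrime

/-! ## §7 (v1.1) (3.61) pointwise for an ARBITRARY (possibly non-linear-packaged) `V′₁`, and the CONCRETE `V′₁(A)` of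
(3.50)–(3.53) (`B9Eq352ScalarFluct.V1p`, this seat's gen-1 file): the chain (3.50)–(3.54) ⟹ (3.61) kernel-connected -/

section Pointwise

variable {X S : Type*} [Fintype X] [DecidableEq S]
variable {E : Type*} [NormedAddCommGroup E] [NormedSpace ℝ E]

/-- `V′(A)λ` at a point, for `V′₁` given as a plain map on configurations (the estimate (3.61) uses no linearity):
`(V′(A)λ)(x) = (V′₁(A)λ)(x) − [F′₂*(aQ′λ) + Q′*(aF′₂λ) + F′₂*(aF′₂λ)](x)`. [cite: Balaban1985BackgroundPropagators, (3.60) p.402] -/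
noncomputable def vPrimeFun (V₁f : (X → E) → X → E) (blk : X → S) (kQ kF : S → X → E →L[ℝ] E) (sQ sF : X → E →L[ℝ] E)
    (c : S → ℝ) (μ : X → E) (x : X) : E :=
  V₁f μ x - (sF x (c (blk x) • kerOp blk kQ μ (blk x)) + sQ x (c (blk x) • kerOp blk kF μ (blk x))
    + sF x (c (blk x) • kerOp blk kF μ (blk x)))

/-- The operator `vPrimeOp` of §2 evaluated at a point IS `vPrimeFun` of the underlying map.
[cite: Balaban1985BackgroundPropagators, (3.60) p.402] -/
theorem vPrimeOp_apply_eq_vPrimeFun (V₁ : Module.End ℝ (X → E)) (blk : X → S) (kQ kF : S → X → E →L[ℝ] E)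
    (sQ sF : X → E →L[ℝ] E) (c : S → ℝ) (μ : X → E) (x : X) :
    vPrimeOp V₁ blk kQ kF sQ sF c μ x = vPrimeFun (fun ν => V₁ ν) blk kQ kF sQ sF c μ x := by
  rw [vPrimeOp_apply, vPrimeFun]

/-- **(3.61), pointwise form** (same constants as `norm_vPrimeOp_le`; `V′₁` and the gradient data `∇_U` enter as plain maps,
so concrete non-packaged operators instantiate it directly). [cite: Balaban1985BackgroundPropagators, (3.61) p.402, (3.54) p.401, (3.58) p.402] -/
theorem norm_vPrimeFun_le (V₁f : (X → E) → X → E) (blk : X → S) (kQ kF : S → X → E →L[ℝ] E)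
    (sQ sF : X → E →L[ℝ] E) (c : S → ℝ) {Y : Type*} (Df : (X → E) → Y → E) (N₁ : X → Y → Prop)
    (N₂ : X → X → Prop) (len w : S → ℝ) (c₁ c₂ C α₁ a₀ : ℝ)
    (hlen : ∀ y, 0 < len y) (hw : ∀ y, 0 ≤ w y) (hcard : ∀ y, ((block blk y).card : ℝ) * w y ≤ 1)
    (hC : 0 ≤ C) (hα : 0 ≤ α₁) (ha₀ : 0 ≤ a₀)
    (h354 : ∀ (μ : X → E) (x : X) (B₁ B₂ : ℝ), (∀ b, N₁ x b → ‖Df μ b‖ ≤ B₁) → (∀ x', N₂ x x' → ‖μ x'‖ ≤ B₂) →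
      ‖V₁f μ x‖ ≤ c₁ * α₁ * (len (blk x))⁻¹ * B₁ + c₂ * α₁ * (len (blk x) ^ 2)⁻¹ * B₂)
    (hkQ : ∀ y x, blk x = y → ‖kQ y x‖ ≤ w y) (hkF : ∀ y x, blk x = y → ‖kF y x‖ ≤ C * α₁ * w y)
    (hsQ : ∀ x, ‖sQ x‖ ≤ 1) (hsF : ∀ x, ‖sF x‖ ≤ C * α₁) (hc : ∀ y, |c y| ≤ a₀ * (len y ^ 2)⁻¹)
    (μ : X → E) (x : X) (B₁ B₂ : ℝ) (hB₁ : ∀ b, N₁ x b → ‖Df μ b‖ ≤ B₁) (hB₂ : ∀ x', N₂ x x' → ‖μ x'‖ ≤ B₂)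
    (hB₂' : ∀ x', blk x' = blk x → ‖μ x'‖ ≤ B₂) :
    ‖vPrimeFun V₁f blk kQ kF sQ sF c μ x‖
      ≤ c₁ * α₁ * (len (blk x))⁻¹ * B₁ + (c₂ + a₀ * C * (2 + C * α₁)) * α₁ * (len (blk x) ^ 2)⁻¹ * B₂ := by
  set y := blk x with hy
  have hB : 0 ≤ B₂ := (norm_nonneg _).trans (hB₂' x rfl)
  have hCα : 0 ≤ C * α₁ := mul_nonneg hC hα
  have hℓ : 0 ≤ (len y ^ 2)⁻¹ := inv_nonneg.mpr (pow_nonneg (hlen y).le 2)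
  have hn : ((block blk y).card : ℝ) * w y ≤ 1 := hcard y
  have hn0 : 0 ≤ ((block blk y).card : ℝ) * w y := mul_nonneg (Nat.cast_nonneg _) (hw y)
  have hT1 : ‖sF x (c y • kerOp blk kQ μ y)‖ ≤ C * α₁ * (a₀ * (len y ^ 2)⁻¹ * B₂) := by
    have h := norm_starTerm_le blk sF kQ c μ x (hsF x) (hw y) (fun x' hx' => hkQ y x' hx') hB₂'
    refine h.trans (mul_le_mul_of_nonneg_left ?_ hCα)
    calc |c y| * (((block blk y).card : ℝ) * w y * B₂) ≤ a₀ * (len y ^ 2)⁻¹ * (1 * B₂) := by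
          refine mul_le_mul (hc y) ?_ (mul_nonneg hn0 hB) (mul_nonneg ha₀ hℓ)
          exact mul_le_mul_of_nonneg_right hn hB
      _ = a₀ * (len y ^ 2)⁻¹ * B₂ := by ring
  have hker : |c y| * (((block blk y).card : ℝ) * (C * α₁ * w y) * B₂) ≤ a₀ * (len y ^ 2)⁻¹ * (C * α₁ * B₂) := by
    calc |c y| * (((block blk y).card : ℝ) * (C * α₁ * w y) * B₂) ≤ a₀ * (len y ^ 2)⁻¹ * (C * α₁ * (1 * B₂)) := by
          refine mul_le_mul (hc y) ?_ ?_ (mul_nonneg ha₀ hℓ)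
          · calc ((block blk y).card : ℝ) * (C * α₁ * w y) * B₂ = C * α₁ * ((((block blk y).card : ℝ) * w y) * B₂) := by
                  ring
              _ ≤ C * α₁ * (1 * B₂) := mul_le_mul_of_nonneg_left (mul_le_mul_of_nonneg_right hn hB) hCα
          · have : 0 ≤ ((block blk y).card : ℝ) * (C * α₁ * w y) := mul_nonneg (Nat.cast_nonneg _) (mul_nonneg hCα (hw y))
            exact mul_nonneg this hB
      _ = a₀ * (len y ^ 2)⁻¹ * (C * α₁ * B₂) := by ring
  have hT2 : ‖sQ x (c y • kerOp blk kF μ y)‖ ≤ 1 * (a₀ * (len y ^ 2)⁻¹ * (C * α₁ * B₂)) :=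
    (norm_starTerm_le blk sQ kF c μ x (hsQ x) (mul_nonneg hCα (hw y)) (fun x' hx' => hkF y x' hx') hB₂').trans
      (mul_le_mul_of_nonneg_left hker zero_le_one)
  have hT3 : ‖sF x (c y • kerOp blk kF μ y)‖ ≤ C * α₁ * (a₀ * (len y ^ 2)⁻¹ * (C * α₁ * B₂)) :=
    (norm_starTerm_le blk sF kF c μ x (hsF x) (mul_nonneg hCα (hw y)) (fun x' hx' => hkF y x' hx') hB₂').trans
      (mul_le_mul_of_nonneg_left hker hCα)
  have hV₁ := h354 μ x B₁ B₂ hB₁ hB₂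
  rw [vPrimeFun]
  calc ‖V₁f μ x - (sF x (c y • kerOp blk kQ μ y) + sQ x (c y • kerOp blk kF μ y) + sF x (c y • kerOp blk kF μ y))‖
      ≤ ‖V₁f μ x‖ + (‖sF x (c y • kerOp blk kQ μ y)‖ + ‖sQ x (c y • kerOp blk kF μ y)‖
          + ‖sF x (c y • kerOp blk kF μ y)‖) := by
        refine (norm_sub_le _ _).trans (add_le_add le_rfl ?_)
        exact (norm_add_le _ _).trans (add_le_add (norm_add_le _ _) le_rfl)
    _ ≤ (c₁ * α₁ * (len y)⁻¹ * B₁ + c₂ * α₁ * (len y ^ 2)⁻¹ * B₂)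
        + (C * α₁ * (a₀ * (len y ^ 2)⁻¹ * B₂) + 1 * (a₀ * (len y ^ 2)⁻¹ * (C * α₁ * B₂))
          + C * α₁ * (a₀ * (len y ^ 2)⁻¹ * (C * α₁ * B₂))) := add_le_add hV₁ (add_le_add (add_le_add hT1 hT2) hT3)
    _ = c₁ * α₁ * (len y)⁻¹ * B₁ + (c₂ + a₀ * C * (2 + C * α₁)) * α₁ * (len y ^ 2)⁻¹ * B₂ := by ring

end Pointwise

section ConcreteV1

open B9Eq39Adjoint B9Eq352ScalarFluct

variable {𝔸 : Type*} [NormedRing 𝔸] [NormedAlgebra ℂ 𝔸] [CompleteSpace 𝔸]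
variable {X : Type*} [Fintype X] {S : Type*} [DecidableEq S] {ι : Type*} [Fintype ι]

omit [NormedAlgebra ℂ 𝔸] [CompleteSpace 𝔸] in
/-- Transport by a unit-bounded background variable does not increase norms: `‖R(V)Z‖ ≦ ‖Z‖` for `‖V‖, ‖V⁻¹‖ ≦ 1` (for a
unitary background the adjoint action is an isometry; only the contraction half is used). [cite: Balaban1985BackgroundPropagators, (3.54) p.401] -/
theorem norm_R_le_of_unit (V : 𝔸ˣ) (Z : 𝔸) (hV : ‖(V : 𝔸)‖ ≤ 1 ∧ ‖((V⁻¹ : 𝔸ˣ) : 𝔸)‖ ≤ 1) : ‖R V Z‖ ≤ ‖Z‖ := by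
  have h := B9Eq370Expansion.norm_R_le V Z
  calc ‖R V Z‖ ≤ ‖(V : 𝔸)‖ * ‖Z‖ * ‖((V⁻¹ : 𝔸ˣ) : 𝔸)‖ := h
    _ ≤ 1 * ‖Z‖ * 1 :=
        mul_le_mul (mul_le_mul_of_nonneg_right hV.1 (norm_nonneg _)) hV.2 (norm_nonneg _)
          (mul_nonneg zero_le_one (norm_nonneg _))
    _ = ‖Z‖ := by ring

omit [Fintype X] in
/-- **(3.54) ⟹ the `h354` input of (3.61), for the CONCRETE `V′₁(A)` of (3.50)–(3.53)** (`B9Eq352ScalarFluct.V1p` on the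
lattice `(T, U)` of `B9Eq39Adjoint`, unit-bounded background, field `A` in the regime (3.37): `|A| ≦ α₁s⁻¹`, `|∇*A| ≦ dα₁s⁻²`,
`ηα₁s⁻¹ ≦ ¼`, single scale `s = L^jη`): `|(V′₁(A)λ)(x)| ≦ 4dα₁s⁻¹B₁ + (2d + 8dα₁)α₁s⁻²B₂` whenever the forward/backward
covariant differences of `λ` AT `x` are `≦ B₁` and `|λ| ≦ B₂` at `x` and its nearest neighbours — this seat's gen-1
`norm_V1p_le_printed` with the transported values bounded through `norm_R_le_of_unit`.
[cite: Balaban1985BackgroundPropagators, (3.54) p.401, (3.37) p.396] -/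
theorem h354_V1p (T : ι → Equiv.Perm X) (U : ι → X → 𝔸ˣ)
    (hU : ∀ μ x, ‖(U μ x : 𝔸)‖ ≤ 1 ∧ ‖(((U μ x)⁻¹ : 𝔸ˣ) : 𝔸)‖ ≤ 1) {η : ℝ} (hη : 0 < η)
    (A : ι → X → 𝔸) {α₁ s : ℝ} (hα : 0 ≤ α₁) (hs : 0 < s) (hsmall : η * (α₁ * s⁻¹) ≤ 1 / 4)
    (hA : ∀ μ x, ‖A μ x‖ ≤ α₁ * s⁻¹)
    (hg : ∀ x, ‖((η : ℂ)⁻¹) • divB T U A x‖ ≤ Fintype.card ι * (α₁ * (s⁻¹) ^ 2))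
    (lam : X → 𝔸) (x : X) (B₁ B₂ : ℝ)
    (hB₁ : ∀ b : X × ι × Bool, b.1 = x →
      ‖(if b.2.2 then ((η : ℂ)⁻¹) • covD T U b.2.1 lam b.1 else ((η : ℂ)⁻¹) • covDstar T U b.2.1 lam b.1)‖ ≤ B₁)
    (hB₂ : ∀ x' : X, (x' = x ∨ ∃ μ, x' = T μ x ∨ x' = (T μ).symm x) → ‖lam x'‖ ≤ B₂) :
    ‖V1p T U η A lam x‖
      ≤ 4 * Fintype.card ι * α₁ * s⁻¹ * B₁ + (2 * Fintype.card ι + 8 * Fintype.card ι * α₁) * α₁ * (s ^ 2)⁻¹ * B₂ := by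
  have hAx : ∀ μ, ‖A μ x‖ ≤ α₁ * s⁻¹ ∧ ‖R (U μ ((T μ).symm x))⁻¹ (A μ ((T μ).symm x))‖ ≤ α₁ * s⁻¹ := by
    intro μ
    refine ⟨hA μ x, ?_⟩
    have hu := hU μ ((T μ).symm x)
    refine (norm_R_le_of_unit _ _ ⟨?_, ?_⟩).trans (hA μ _)
    · simpa using hu.2
    · simpa using hu.1
  have hD : ∀ μ, ‖((η : ℂ)⁻¹) • covD T U μ lam x‖ ≤ B₁ ∧ ‖((η : ℂ)⁻¹) • covDstar T U μ lam x‖ ≤ B₁ := by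
    intro μ
    constructor
    · have := hB₁ (x, μ, true) rfl
      simpa using this
    · have := hB₁ (x, μ, false) rfl
      simpa using this
  have hl : ‖lam x‖ ≤ B₂ := hB₂ x (Or.inl rfl)
  have hY : ∀ μ, ‖R (U μ x) (lam (T μ x))‖ ≤ B₂ ∧ ‖R (U μ ((T μ).symm x))⁻¹ (lam ((T μ).symm x))‖ ≤ B₂ := by
    intro μ
    constructor
    · exact (norm_R_le_of_unit _ _ (hU μ x)).trans (hB₂ _ (Or.inr ⟨μ, Or.inl rfl⟩))
    · have hu := hU μ ((T μ).symm x)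
      refine (norm_R_le_of_unit _ _ ⟨?_, ?_⟩).trans (hB₂ _ (Or.inr ⟨μ, Or.inr rfl⟩))
      · simpa using hu.2
      · simpa using hu.1
  have h := norm_V1p_le_printed T U hη A lam x hα hs hsmall hAx hD (hg x) hl hY
  have hs2 : (s⁻¹) ^ 2 = (s ^ 2)⁻¹ := by rw [inv_pow]
  rw [hs2] at h
  refine h.trans (le_of_eq ?_)
  ring

/-- **(3.61) for the CONCRETE `V′₁(A)` of (3.50)–(3.53)** on a finite lattice (sites `X`, unit-bounded background, single
scale `s = L^jη`, the averaging/starred/`a` carriers of §2 with the (3.19)/(3.58)-shape kernel bounds):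
`|(V′(A)λ)(x)| ≦ 4dα₁s⁻¹B₁ + (2d + 8dα₁ + a₀C(2 + Cα₁))α₁s⁻²B₂` for `|∇_Uλ| ≦ B₁` on the bonds at `x` and `|λ| ≦ B₂` on `x`,
its nearest neighbours and its block — the chain (3.50)–(3.54) ⟹ (3.61) kernel-connected, O(1) explicit.
[cite: Balaban1985BackgroundPropagators, (3.61) p.402, (3.54) p.401] -/
theorem norm_vPrimeFun_V1p_le (T : ι → Equiv.Perm X) (U : ι → X → 𝔸ˣ)
    (hU : ∀ μ x, ‖(U μ x : 𝔸)‖ ≤ 1 ∧ ‖(((U μ x)⁻¹ : 𝔸ˣ) : 𝔸)‖ ≤ 1) {η : ℝ} (hη : 0 < η)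
    (A : ι → X → 𝔸) {α₁ s : ℝ} (hα : 0 ≤ α₁) (hs : 0 < s) (hsmall : η * (α₁ * s⁻¹) ≤ 1 / 4)
    (hA : ∀ μ x, ‖A μ x‖ ≤ α₁ * s⁻¹)
    (hg : ∀ x, ‖((η : ℂ)⁻¹) • divB T U A x‖ ≤ Fintype.card ι * (α₁ * (s⁻¹) ^ 2))
    (blk : X → S) (kQ kF : S → X → 𝔸 →L[ℝ] 𝔸) (sQ sF : X → 𝔸 →L[ℝ] 𝔸) (c w : S → ℝ) (C a₀ : ℝ)
    (hw : ∀ y, 0 ≤ w y) (hcard : ∀ y, ((block blk y).card : ℝ) * w y ≤ 1) (hC : 0 ≤ C) (ha₀ : 0 ≤ a₀)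
    (hkQ : ∀ y x, blk x = y → ‖kQ y x‖ ≤ w y) (hkF : ∀ y x, blk x = y → ‖kF y x‖ ≤ C * α₁ * w y)
    (hsQ : ∀ x, ‖sQ x‖ ≤ 1) (hsF : ∀ x, ‖sF x‖ ≤ C * α₁) (hc : ∀ y, |c y| ≤ a₀ * (s ^ 2)⁻¹)
    (lam : X → 𝔸) (x : X) (B₁ B₂ : ℝ)
    (hB₁ : ∀ μ, ‖((η : ℂ)⁻¹) • covD T U μ lam x‖ ≤ B₁ ∧ ‖((η : ℂ)⁻¹) • covDstar T U μ lam x‖ ≤ B₁)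
    (hB₂ : ∀ x' : X, (x' = x ∨ ∃ μ, x' = T μ x ∨ x' = (T μ).symm x) → ‖lam x'‖ ≤ B₂)
    (hB₂' : ∀ x', blk x' = blk x → ‖lam x'‖ ≤ B₂) :
    ‖vPrimeFun (fun ν z => V1p T U η A ν z) blk kQ kF sQ sF c lam x‖
      ≤ 4 * Fintype.card ι * α₁ * s⁻¹ * B₁
        + (2 * Fintype.card ι + 8 * Fintype.card ι * α₁ + a₀ * C * (2 + C * α₁)) * α₁ * (s ^ 2)⁻¹ * B₂ := by
  have h := norm_vPrimeFun_le (fun ν z => V1p T U η A ν z) blk kQ kF sQ sF c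
    (fun ν (b : X × ι × Bool) =>
      if b.2.2 then ((η : ℂ)⁻¹) • covD T U b.2.1 ν b.1 else ((η : ℂ)⁻¹) • covDstar T U b.2.1 ν b.1)
    (fun z b => b.1 = z) (fun z x' => x' = z ∨ ∃ μ, x' = T μ z ∨ x' = (T μ).symm z) (fun _ => s) w
    (4 * Fintype.card ι) (2 * Fintype.card ι + 8 * Fintype.card ι * α₁) C α₁ a₀ (fun _ => hs) hw hcard hC hα ha₀
    (fun ν z B₁ B₂ h1 h2 => h354_V1p T U hU hη A hα hs hsmall hA hg ν z B₁ B₂ h1 h2)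
    hkQ hkF hsQ hsF hc lam x B₁ B₂
    (fun b hb => by
      obtain ⟨x', μ, fwd⟩ := b
      simp only at hb
      subst hb
      cases fwd
      · simpa using (hB₁ μ).2
      · simpa using (hB₁ μ).1)
    hB₂ hB₂'
  exact h

end ConcreteV1

/-! ## §8 (v1.2) (3.68) p. 403: `P(U′U) = P(U) + P′(A)` — `P′(A)` DEFINED, and *"The remainder can be written explicitly in terms of
the operators introduced until now by writing the expansions of the operators determining P(U′U)"* carried out (ring algebra;
SKELETON row B9.Eq3.68) -/

section PPrime

variable {R : Type*} [Ring R]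

/-- `P(U) = I − R(U) = G′Q′*(Q′G′²Q′*)^{−1}Q′G′` (from (3.25) `R = I − G′Q′*(Q′G′²Q′*)^{−1}Q′G′`), as a word in the letters
`G = G′(U)`, `Qs = Q′*(U)`, `Cinv = (Q′G′²Q′*)^{−1}(U)`, `Q = Q′(U)`. [cite: Balaban1985BackgroundPropagators, (3.25) p.394, (3.68) p.403] -/
def pOp (G Qs Cinv Q : R) : R := G * Qs * Cinv * Q * G

/-- **`P′(A)` of (3.68)**, DEFINED by `P(U′U) = P(U) + P′(A)`: `P′(A) := P(U′U) − P(U)` with `P(U′U)` the same word in the extended letters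
`E = G′(U′U)`, `Qs′ = Q′*(U′U)`, `Cinv′ = (Q′G′²Q′*)^{−1}(U′U)`, `Q′ = Q′(U′U)`. [cite: Balaban1985BackgroundPropagators, (3.68) p.403] -/
def pPrime (G E Qs Qs' Cinv Cinv' Q Q' : R) : R := pOp E Qs' Cinv' Q' - pOp G Qs Cinv Q

/-- **(3.68), first line**: `P(U′U) = P(U) + P′(A)`. [cite: Balaban1985BackgroundPropagators, (3.68) p.403] -/
theorem eq368 (G E Qs Qs' Cinv Cinv' Q Q' : R) :
    pOp E Qs' Cinv' Q' = pOp G Qs Cinv Q + pPrime G E Qs Qs' Cinv Cinv' Q Q' := by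
  rw [pPrime]; abel

/-- The remainder telescoped: `P′(A)` is a sum of five words, each containing exactly ONE difference of an extended and an
unextended letter. [cite: Balaban1985BackgroundPropagators, (3.68) p.403] -/
theorem pPrime_telescope (G E Qs Qs' Cinv Cinv' Q Q' : R) :
    pPrime G E Qs Qs' Cinv Cinv' Q Q'
      = (E - G) * Qs' * Cinv' * Q' * E + G * (Qs' - Qs) * Cinv' * Q' * E + G * Qs * (Cinv' - Cinv) * Q' * E
        + G * Qs * Cinv * (Q' - Q) * E + G * Qs * Cinv * Q * (E - G) := by
  rw [pPrime, pOp, pOp]; noncomm_ring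

/-- Second resolvent identity for the inverses of (3.67): if `L′ = L + C′(A)`, `Cinv′L′ = 1` and `L·Cinv = 1` then
`Cinv′ − Cinv = −Cinv′C′(A)Cinv`. [cite: Balaban1985BackgroundPropagators, (3.67) p.403] -/
theorem inv_sub_inv_of_367 (L L' Cp Cinv Cinv' : R) (h365 : L' = L + Cp) (hinv' : Cinv' * L' = 1) (hinv : L * Cinv = 1) :
    Cinv' - Cinv = -(Cinv' * Cp * Cinv) := by
  have e : Cinv' - Cinv = Cinv' * (L - L') * Cinv := by
    rw [mul_sub, sub_mul, mul_assoc Cinv' L Cinv, hinv, mul_one, hinv', one_mul]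
  rw [e, h365]; noncomm_ring

/-- **(3.68), the remainder written explicitly** (*"by writing the expansions of the operators determining P(U′U)"*): with (3.57)
`Q′(U′U) − Q′(U) = F′₂(A)`, `Q′*(U′U) − Q′*(U) = F′₂*(A)`, (3.65) `G′(U′U) − G′(U) = G′(U)V′(A)G′(U′U)` and (3.67)
`Cinv′ − Cinv = −Cinv′C′(A)Cinv`, every term of `P′(A)` carries one small factor (`V′`, `F′₂`, `F′₂*` or `C′`).
[cite: Balaban1985BackgroundPropagators, (3.68) p.403] -/
theorem pPrime_explicit (G E Qs Qs' Cinv Cinv' Q Q' V F₂ F₂s Cp : R) (h365 : E = G + G * V * E)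
    (h357 : Q' = Q + F₂) (h357s : Qs' = Qs + F₂s) (hC : Cinv' - Cinv = -(Cinv' * Cp * Cinv)) :
    pPrime G E Qs Qs' Cinv Cinv' Q Q'
      = G * V * E * Qs' * Cinv' * Q' * E + G * F₂s * Cinv' * Q' * E - G * Qs * (Cinv' * Cp * Cinv) * Q' * E
        + G * Qs * Cinv * F₂ * E + G * Qs * Cinv * Q * (G * V * E) := by
  have hE : E - G = G * V * E := by
    calc E - G = (G + G * V * E) - G := by rw [← h365]
      _ = G * V * E := by abel
  have hQ : Q' - Q = F₂ := by rw [h357]; abel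
  have hQs : Qs' - Qs = F₂s := by rw [h357s]; abel
  rw [pPrime_telescope, hE, hQ, hQs, hC]
  noncomm_ring

end PPrime

/-! ## §9 (v1.3) *"Each term in the series is analytic in A on the domain (3.37), and the series is convergent uniformly, hence
G′(U′U) is an analytic function of A also"* (p. 402 after (3.64)) — for `gPrimeExt`, by the kernel lemma of
`B9Eq386NeumannAnalytic` (pub-balaban NE9 seat, p244553; folded here at that seat's invitation) -/

section Analytic

variable {𝕜 : Type*} [NontriviallyNormedField 𝕜]
variable {R : Type*} [NormedRing R] [NormedAlgebra 𝕜 R] [CompleteSpace R]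
variable {E : Type*} [NormedAddCommGroup E] [NormedSpace 𝕜 E]

/-- **p. 402 after (3.64)**: if the perturbation `A ↦ V′(A)` is analytic at `A` (in any normed space of configurations `E`) and
`‖V′(A)G′(U)‖ < 1`, then `B ↦ G′(U′U) = gPrimeExt G′(U) (V′(B))` is analytic at `A` — `B9Eq386NeumannAnalytic.analyticAt_gNew_comp`
verbatim (`gPrimeExt = gNew` by `rfl`). [cite: Balaban1985BackgroundPropagators, (3.64) p.402] -/
theorem analyticAt_gPrimeExt_comp (Gp : R) {Vp : E → R} {A : E} (hV : AnalyticAt 𝕜 Vp A) (h : ‖Vp A * Gp‖ < 1) :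
    AnalyticAt 𝕜 (fun B => gPrimeExt Gp (Vp B)) A :=
  B9Eq386NeumannAnalytic.analyticAt_gNew_comp Gp hV h

/-- The same on a set `D` of configurations (*"on the domain (3.37)"*). [cite: Balaban1985BackgroundPropagators, (3.64) p.402, (3.37) p.396] -/
theorem analyticOnNhd_gPrimeExt_comp (Gp : R) {Vp : E → R} {D : Set E} (hV : AnalyticOnNhd 𝕜 Vp D)
    (h : ∀ A ∈ D, ‖Vp A * Gp‖ < 1) : AnalyticOnNhd 𝕜 (fun B => gPrimeExt Gp (Vp B)) D :=
  fun A hA => analyticAt_gPrimeExt_comp Gp (hV A hA) (h A hA)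

end Analytic

end Literature.MathematicalPhysics.QuantumFieldTheory.Balaban1983to89.B9Eq360Vprime
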